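import Literature.MathematicalPhysics.QuantumFieldTheory.Balaban1983to89.B15From190LayerSizes
import Literature.MathematicalPhysics.QuantumFieldTheory.Balaban1983to89.B11Ineq73HasMajConcrete
import Literature.MathematicalPhysics.QuantumFieldTheory.Balaban1983to89.B11Ineq190DerivConcreteC

/-!
# `Balaban1983to89.B15From190ConcreteC` — T. Bałaban, *Large field renormalization. I. The basic step of the 𝐑 operation*,
# Commun. Math. Phys. **122** (1989) 175–202 [Balaban1989LargeFieldI] = [IV], §1: the (190)-knittings of (1.42), (1.37)–(1.39) and
# (1.57)/(1.54)₂ — and (v1.1) of (1.31), (1.90)–(1.91), (1.45)–(1.48), (1.96) WITH THEIR COVARIANT-DERIVATIVE OUTPUT SIZES — AT THE CONCRETE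
# REMAINDER `C_j(U₁, ·)` OF [4] ON r08's SINGLE-SCALE CUBE GEOMETRY — (190) itself, the mean-value reading, the (73) majorant, [3] (2.54) and
# Lemma 2.1 (2.61), and the size ↔ norm letters `hN`/`hBloc` ALL SUPPLIED BY NAME

statement-level skeleton of published theorems with citation tags; proofs where landed; nothing here is a claim
about the Yang–Mills mass gap

CITATION HEADER (lean-in-tree rule 2026-08-18).  T. Bałaban, *Large field renormalization. I. The basic step of the 𝐑 operation*,
Commun. Math. Phys. **122**, 175–202 (1989), doi:10.1007/BF01257412, bib `Balaban1989LargeFieldI` (cell paper B15 = "[IV]"; PDF held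
`paper:balaban1989-cmp122-large-field-i`, journal page = PDF page + 174; pp. 184–188 = PDF 10–14).  "[15]" = T. Bałaban, *The variational
problem and background fields in renormalization group method for lattice gauge theories*, Commun. Math. Phys. **102**, 277–309 (1985), bib
`Balaban1985Variational` (cell paper B11; Prop. 9 p. 309, (190) p. 308, (179)–(180) p. 306, (189) p. 308, (73) and Prop. 3 p. 289, (44)/(46)
p. 285).  "[4]" = [Balaban1985Averaging] (CMP **98**) Props. 4–5 pp. 38–42 (the remainder `C_j(U₀, ·)`).  "[3]" = [Balaban1984PropagatorsII]
Lemma 2.1 (2.61) p. 234 (`B11SectG.RowSum`), (2.54) p. 233 (`Triangle254`), (2.64)–(2.66) p. 235.  Mega-formalization `lit-balaban`, HOME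
`run/shared/lean/pub/lit-balaban/`, unit `lit-balaban-r12` gen 12 (reader/typer and fold owner of block B15; cell GAPS.md G-B15-r12-08 — this file
is its Addendum 6 in the tree: after gen 11's `B15From190SectG` closed items (a) «(190) between the concrete sizes» and (e′) «the mean-value
reading» for every (190)-consuming row, the located leaves (73) `hDfr`, [3] (2.54) `htri`, (2.61) `hrow`/`hrow8`, `hdist`, `hN`, `hBloc` and the
Sect. C letters `hTm`/`hTm0` are discharged too, at the price of fixing the Sect. C datum to the CONCRETE `C_j` of [4] and the block geometry to
r08's single-scale cube geometry — following r08 gen 11's `B11Ineq73HasMajConcrete` (p309726) and its STATUS note 2026-08-21T23:35:31Z).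

WHAT IS REPRODUCED.  SKELETON rows **B15.Eq1.42** (with 1.40–1.41), **B15.Eq1.37**/**B15.Eq1.39** (with 1.34–1.36, 1.38), **B15.Eq1.54**/**B15.Eq1.57**
(with 1.56, 1.58); v1.1: **B15.Eq1.31** (with 1.30), **B15.Eq1.91** (with 1.90), **B15.Eq1.48** (with 1.44–1.47), **B15.Eq1.96** (with
1.92–1.95) — cells only, every head already `proved`.  THE PRINT (verbatim, re-read on the page images for v1.2; the sentences whose words
*"exponential decay property"* cite [15] (190)): p. 185 *"From this, and the exponential decay property, it follows that [(1.38)] … the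
expression on the left-hand side of (1.37) can be bounded by ½δ_j"*, *"The function ℍ_{j+1,□′} is bounded on □′^{∼2} by B₃exp(−δLM₂R_{j+1})22d²ε_{j+1},
hence [(1.42)] ≦ ½δ_j"*; p. 188 *"The field in the argument of the function ℍ^{(n+1)}_{k,Z} has a support in the boundary layer of the width 2M₁ at
the boundary of Z, and is bounded by 44d²B₃ε_k. Thus the function considered on the domain Ω^c_{j+1}∖Z″_{j+1} satisfies the bound |ℍ^{(n+1)}_{k,Z}| ≦
(L^{j+1}η)^{−1}B₃exp(−δ10M(R_{j+1}+⋯+R_{k−1}) − δMR_k)44d²B₃ε_k < … (1.57)"* and p. 187 *"the second expression on the right-hand side [of (1.54)]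
is much smaller than δ′_j"*; (v1.1) p. 183–184 *"The exponential decay property of ℍ_{j,□} implies that on the cube □^∼ this function and its
covariant derivatives can be bounded by B₃exp(−δ2M₂R_j)22d²ε_j"* ((1.31)), p. 186 *"therefore the following estimate holds: [(1.45)] … Using the
representation (1.44), and the above estimate, we obtain [(1.46)] … Then the estimate (1.46) and the above bounds imply [(1.48)]"*, p. 198 *"The
function ℍ_{h,□} and it[s] derivatives can be bounded on □^∼ by B₃exp(−δ2LM₂R_h)11d²ε_h < 11d²B₃exp(−R_h)ε_h < αε_h, … Estimating as in (1.46) we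
get [(1.91)]"*, p. 199 *"The estimates (1.91), (1.95) yield [(1.96)]"*.  [15] (190) p. 308: *"|(δ/δB_ν(y′))𝓗_μ(B,x)|, … ≦
O(1)[(L^jη)^{−1}, (L^jη)^{−2}, …]·(L^{j′}η)^{−d}exp(−⅛δ₀d(y,y′)) (190) for x ∈ Δ(y), … y ∈ Λ_j, y′ ∈ Λ_{j′}"*; (73) p. 289: *"|𝔇(A′; c, b)| ≦
O(1)C₃ε₃(L^jη)^{−d+1}e^{−(1/2)δ₀d(c₋,y)}, b ∈ B^j(y), y ∈ Λ_j"* (read in the tree in the kernel form of p06's `B11Eq73KernelConcrete`, as in r08's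
`B11Ineq73HasMajConcrete`); Prop. 3 p. 289; (44) p. 285 *"The Proposition 4 of [4] implies Q_j(ηA) = L^jηQ_jA + C_j(L^jηA), |C_j(L^jηA)| ≦
C₂(L^jη)²|A|²"*.  (v1.2, r12 gen 19, `lit-balaban-r12/QUOTE-AUDIT-B15.md` findings A7–A10: DOCSTRING ONLY — six passages of this header that v1/v1.1
carried inside quotation marks were paraphrases, not the printed words («it can be estimated there by 44d²B₃ε_k. This implies …», «this function
can be estimated on the cube … the same estimate holds for covariant derivatives of this function», «|ℍ^{(n)}_k|, |∇ℍ^{(n)}_k| < … (1.46) … hence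
(1.48)», «|ℍ_{h,□}|, |∇…ℍ_{h,□}| < αε_h (1.90) … Thus the inequality (1.91) holds», (73) in the tree's simplified kernel form, (44) with the
unprinted words «that it is an analytic function of A»); restored verbatim above; no declaration, statement or proof changed.)

THE CHAIN, BY NAME (nothing restated, nothing modified).  r12's layer-level knits `B15From190LayerSizes.ineq142_le_half_of_ineq190_layer` (1.42),
`ineq139_half_of_ineq190_layer` (1.37)–(1.39), `second154_lt_of_ineq190_layer` (1.57)/(1.54)₂ (gens 9–10; input size `supSize g boxB blkB` on the
bond index set of p29's towers, B-sizes and localisations discharged there) take ONE pair of located hypotheses each: `h190 : ∀ t, Ineq190 (supSize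
g boxB blkB) (supSize g box blk) (dH t) C δ₀` and the mean-value domination `hmv`.  r08 gen 11's
`B11Ineq73HasMajConcrete.ineq190_and_hmv_supSize_concreteC_kernel` PRODUCES this pair for any lattice presentation `ev` of the (179) chart
`𝓗 = chartH179 𝒢 W D2 H₀ (· − H(Dfix(C_j(U₁,·)) ·)) ε₄` at the CONCRETE remainder `C_j(U₁, ·) = B11Eq44Concrete.Cmap L U₁ S T j` of [4] on `ℤᵈ`
(Sect. C selector `D = B11Prop3Model.Dfix` = the solution of (49); Prop. 3's inputs = the theorem `B11Prop3Concrete.inputs_concrete`, analyticity of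
`C_j` = `B12SecondOrder267Concrete.analyticOnNhd_Cmap`), ON THE SINGLE-SCALE CUBE GEOMETRY `cubeGeometry L j S T` of the pair (fine bonds `S`,
coarse bonds `T`) with the sup sizes of the fine / coarse bonds, where the (73) majorant of the actual derivative of `Dfix` comes from the H-kernel
letter `hHker` through the kernel ↔ block-size dictionary (`hasMaj_fderiv_Dfix`), [3] (2.54) is the `ℓ¹` triangle inequality
(`triangle254_cubeGeometry`), (2.61) at the rate `⅛δ₀` is `rowSum_cubeGeometry` (constant `c₀(δ₀,⅛)ᵈ`), and `hN`/`hBloc` are the sharp-box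
letters `loc_le_norm_supSize`/`norm_le_loc_of_isLoc`; r12 gen 12's `B11Ineq190DerivConcreteC.ineq190_and_hmv_covDerivBlockSize_concreteC_kernel` /
`ineq190_and_hmv_ofSeminorms_concreteC_kernel` (v1.1's new import) PRODUCE the same pair for the COVARIANT-DERIVATIVE output size
`covDerivBlockSize (cubeGeometry L j S T) y₀ Sc ξ U₀` and for the WEIGHTED first-order seminorm size `ofSeminorms … y₀ (cw • covDerivSize (Sc ·) η U₀)`
(first-order compatibility letter `hev₁`/`hevw₁` in place of `hev`).  THIS FILE COMPOSES the two: the towers of [IV] are INDEXED BY THE COARSE BONDS `T` (so the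
scheme's `B`-space IS `𝔸^T` and the knit's input size IS the coarse sup size `supSize (cubeGeometry L j S T) boxT blkT`), the knit's own row sum
[3] (2.61) at the rate `σ = αδ₀` (`σ + τ ≤ ⅛δ₀`, constant `c₀(δ₀,α)ᵈ`) is `rowSum_cubeGeometry`, its `hdist` is `dist_nonneg_cubeGeometry`, and
`0 ≤ const190 …` is bookkeeping (§0).

WHAT THIS FILE PROVES (kernel-checked, zero `sorry`; theorems only — no `def`, no new `Prop`, no named fact; axioms standard).
§0 (private) `const190_nonneg'`, `thetaD_nonneg` (the (73) weight `θ_𝔇` of the cube geometry is `≥ 0` under its smallness), `c0_pow_nonneg`.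
§1 `ineq142_le_half_layer_concreteC` — **(1.42) «≦ ½δ_j»** at the concrete `C_{j+1}(U₁, ·)` (print: `ℍ_{j+1,□′}` is the function of the
   `(j+1)`-operation, (1.40)), cube geometry at scale `j + 1`, with `h190`, `hmv`, `hdist`, `hrow`, AND — inside r08's theorem — (73), (2.54),
   (2.61) at `⅛δ₀`, `hN`, `hBloc`, `hTm`/`hTm0` ALL DISCHARGED.
§2 `ineq139_half_layer_concreteC` — **(1.37)–(1.39), lhs of (1.37) «≤ ½δ_j»** at the concrete `C_j(U₁, ·)`, cube geometry at scale `j` (print's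
   two regions / three pieces of the (1.34) argument field on the coarse bonds `T`), same discharges; strict weight `const190·c₀(δ₀,α)ᵈ < B₃`.
§3 `second154_lt_layer_concreteC` — **(1.57) ⇒ the second expression of (1.54)** at the concrete `C_k(U₁, ·)`, cube geometry at scale `k`, the
   weighted sup output size at `(L^{k−j−1})⁻¹ • ℍ` through the WEIGHTED presentation `x ↦ (L^{k−j−1})⁻¹ • ev x` (letter `hevw`), same discharges.
§4 (v1.1) `ineq131_lt_layer_concreteC` — **(1.31) ⇒ the functions (1.3) equal 1** at the concrete `C_j(U₁, ·)`, cube geometry at scale `j`, BOTH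
   output sizes (sup on the cube AND the covariant derivatives `covDerivBlockSize … y₀ Sc ξ U₀`): the sup pair from r08's theorem, the covariant
   pair from r12's `B11Ineq190DerivConcreteC.ineq190_and_hmv_covDerivBlockSize_concreteC_kernel`; same discharges.
§5 (v1.1) `ineq191_twoSup_layerW_concreteC` — **(1.90) ⇒ (1.91)** at the concrete `C_K(U₁, ·)`, cube geometry at scale `K`, the tower's fine
   field `Wf` free (print: `U″_{k,Z}`), both output sizes, same discharges.
§6 (v1.1) `ineq148_layer_concreteC` — **(1.46) ⇒ (1.48)** at the concrete `C_j(U₁, ·)`, cube geometry at scale `j`, print's WEIGHTED output sizes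
   (1.45) through the weighted presentation `x ↦ (L^iη) • ev x` (letters `hevw`, `hevw₁`): the sup pair from r08's theorem, the weighted
   first-order pair from r12's `ineq190_and_hmv_ofSeminorms_concreteC_kernel` (scale `cw = (L^iη).toNNReal`); same discharges.
§7 (v1.1) `ineq196_twoSup_layer_concreteC` — **(1.96)** at the concrete `C_K(U₁, ·)`: chain 1 (= (1.90)/(1.91)) with both pairs from the concrete
   theorems, chain 2 through the printed (1.94); same discharges.
VERSIONS.  v1 = p311256 (§§0–3).  v1.1 (this file) is APPEND-ONLY: one new import (`B11Ineq190DerivConcreteC`, p312211), §§4–7 added, no v1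
declaration touched (DOCFIX P35-001 at this touch: the locator of (1.27) is p. 182, corrected in the §2 docstring; no statement change).
HONEST SCOPE.  Assembly of landed theorems BY NAME (r12 `B15From190LayerSizes` p297978/p298425; r08 `B11Ineq73HasMajConcrete` p309726 ←
`B11Ineq190ConcreteC` p305805 ← `B11Ineq190FromProp3`/`B11Prop3Concrete`; p06's concrete Sect. C files).  MODEL-INSTANCE CHARACTER: [15]'s function
`𝓗(B)` of Prop. 9 belongs to the `k`-th renormalization transformation with its SEQUENCE of averaging operations and [3]'s MULTI-SCALE geometry
`{Λ_j}`, `d(y, y′)`; r08's concrete Sect. C datum is the SINGLE-SCALE remainder `C_j(U₁, ·)` of [4] on `ℤᵈ` and `cubeGeometry L j S T` is ONE layer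
`Λ_j` (block distance `|y − y′|₁` in `Lʲ`-units, r08's honest scope); the theorems here are therefore the single-scale concrete instances of gen
11's `B15From190SectG` theorems (which keep the scheme and the geometry abstract), not a construction of [IV]'s multi-scale `ℍ^{(n)}_{k,Z}`.  The
scale of the instance is print's (`j + 1` for (1.42), `j` for (1.37)–(1.39), `k` for (1.57)); the background `U₁` of `C_·` (regular in the sense
of [4]: `pdev U₁ < α₁L^{−2k₁}` etc.) is kept DISTINCT from the towers' fine fields `U₀`/`U` and the consumer's background (print: one
configuration — instantiate `U₁ := U₀`).  What is LEFT as hypothesis in every theorem here, exactly: (i) r08's located leaves of [15] Sect. G for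
the ABSTRACT data `G̃` (`hG190`), `Δ⁽²⁾H₀` (`hD2H0`), `H₀` (`hH0`), `H` (`hH`) as majorants between the cube sizes, (189) `h189` on the domain of
(180) (author-omitted, G-B11-G2), the smallness `q_G < 1` of (187) with the constant `c₀(δ₀,⅛)ᵈ`, the H-kernel letter `hHker` ([5] Thm 3.12 in
kernel form) with its smallness `hq`, the Sect. G `Regime 𝒢 0 W B₀ θ C₄ a₃ 𝔧 𝔞 ε₄`, `W`-analyticity on `‖Y‖ < a₃`, (46) `‖HX‖ ≤ B₀′‖X‖`, the
Prop. 3 smallness in tree units (`18·C₂(Lʲ)²·B₀′·d·c1h·ε₃ ≤ 1`, `2ε₃ ≤ b₁/2`, `ε₄ + 𝔞 ≤ ε₃`), the [4] regime of `U₁` (`hα₁…h155₁`), the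
argument field in the domain of (180) (`hB`); (ii) the (115)-presentation letter `hev` (resp. `hevw`) — real CLMs `ev x : 𝔸^S →L[ℝ] (Fin d → 𝔸)`
reading off the values at the lattice point `x`, dominated on the output box of `y` by the sup size of the fine bonds; (iii) the knits' own
located side conditions verbatim (box/tower GEOMETRY `hbox`/`hX`/`hfar…` — now in the cube distance —, `hgeom`, p29's lattice regularity data, the
explicit γ- and α₀-clauses, the weight `const190·c₀(δ₀,α)ᵈ ≤ B₃` of (190)'s explicit constant against print's `B₃`).  NOT covered (v1.1): (1.98)
`B15From190LayerSizes.ineq198_twoSup_of_ineq190_layer199` — its two chains are two (179) charts with two argument-bond index sets, i.e. two cube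
geometries `cubeGeometry L K S T₁`/`cubeGeometry L K S T₂`, while the knit is stated on ONE block geometry; and the mean-value-discharged variants
(`…_mv`) of `B15From190LayerSizes` v1.2, whose `Hop 0 = 0` letter is not a property of the (179) chart at a general `H₀ B`.  NOT summit progress.  r12 gen 12
(literature-prover-lit-balaban-r12-g12-0).
v1.2 (r12 gen 14, 2026-08-22): CITELOC DOCFIX ONLY — the four locators «(115) p.295» now read «(115) p.294» ([Balaban1985Variational] display (115)
is the last display of p. 294 = PDF 18 l. 34; (117) opens p. 295; r08 gen-13 citeloc map, re-run by this seat over the non-B11 files and re-read on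
the text layer); no declaration, statement or proof changed.
-/

noncomputable section

open scoped BigOperators NNReal
open NormedSpace Set

namespace Literature.MathematicalPhysics.QuantumFieldTheory.Balaban1983to89.B15From190ConcreteC

open Literature.MathematicalPhysics.QuantumFieldTheory.Balaban1983to89
open MatrixLog B7Prop1Explicit B7Prop2Explicit B7Prop1Local B7Prop3Flat B7Prop4Flat B7Eq92Concrete B7Eq162General
  B8Lemma1NonAbelian B8Ineq129 B8Ineq130 B8Ineq165Descent B15Ineq184BlockAxial B15Ineq184Local B8Eq115GaugeFixing
  B14ArgField36Lattice B15LayerLocal B15LayerSupSize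
open B7Prop3GeneralLinear B7Prop4GeneralLevels B7Prop5GeneralOperators B7Prop5GeneralInduction B7Prop5GeneralLevels
  B7Prop5General B7Ineq149Pairing B13Contraction113 B11Eq44Concrete B11Prop3Model
open B6RandomWalk B11SectG B11SupSize190 B11SeminormSize190 B11Eq174Chart B11Eq183Differentiation B11Presentation190
  B11Ineq190Actual B11Ineq190FromProp3 B11Ineq73HasMajConcrete B15From190LayerSizes B11Ineq190DerivConcreteC
open B15.Ineq194Flow

variable {d : ℕ}

/-! ## §0 Bookkeeping: the (190) constant is non-negative; the (73) weight `θ_𝔇` of the cube geometry is non-negative -/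

/-- The (190) constant `const190 κ_B κ_N κ₃ B_G θ_W c_Δ A₀ A_H θ_𝔇 c` of `B11SectG` is `≥ 0` for non-negative data under the
smallness `q < 1` of (187) (as in `B14From190SectG`/`B15From190SectG`, private there). [cite: Balaban1985Variational, (187)–(190) p.308] -/
private theorem const190_nonneg' {κB κN κ₃ BG θW cΔ A₀ AH θD c : ℝ} (hκB : 0 ≤ κB) (hκN : 0 ≤ κN) (hκ₃ : 0 ≤ κ₃)
    (hc : 0 ≤ c) (hBG : 0 ≤ BG) (hθW : 0 ≤ θW) (hcΔ : 0 ≤ cΔ) (hA₀ : 0 ≤ A₀) (hAH : 0 ≤ AH) (hθD : 0 ≤ θD)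
    (hq : qG κ₃ κN BG θW c < 1) : 0 ≤ const190 κB κN κ₃ BG θW cΔ A₀ AH θD c := by
  unfold const190
  have h₁ := constA0_nonneg (cΔ := cΔ) hκ₃ hκN hBG hθW hcΔ hA₀ hc hq
  positivity

/-- The (73) weight `θ_𝔇 = d·e^{½dδ₀}·(1 − q)⁻¹·e^{dδ₀}·C₃(Lʲ)²·2ε` of `B11Ineq73HasMajConcrete.hasMaj_fderiv_Dfix` is `≥ 0` under its
smallness `q < 1`. [cite: Balaban1985Variational, (73) p.289] -/
private theorem thetaD_nonneg {L j : ℕ} {δ₀ ε B₁ : ℝ} (hε : 0 ≤ ε)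
    (hq : (C3Gen d L * (((L : ℝ) ^ j) ^ 2 * (2 * ε)) * (2 * d) * B₁ * Real.exp (2 * d * δ₀)) * (d * B6.c0 δ₀ (1 / 2) ^ d) < 1) :
    (0 : ℝ) ≤ d * Real.exp (1 / 2 * d * δ₀) *
      ((1 - (C3Gen d L * (((L : ℝ) ^ j) ^ 2 * (2 * ε)) * (2 * d) * B₁ * Real.exp (2 * d * δ₀)) *
          (d * B6.c0 δ₀ (1 / 2) ^ d))⁻¹ * (Real.exp (d * δ₀) * (C3Gen d L * ((L : ℝ) ^ j) ^ 2 * (2 * ε)))) := by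
  have hC3 : 0 ≤ C3Gen d L := by unfold C3Gen C1ppGen; positivity
  have h1q : 0 < 1 - (C3Gen d L * (((L : ℝ) ^ j) ^ 2 * (2 * ε)) * (2 * d) * B₁ * Real.exp (2 * d * δ₀)) *
      (d * B6.c0 δ₀ (1 / 2) ^ d) := by linarith
  exact mul_nonneg (by positivity) (mul_nonneg (inv_nonneg.2 h1q.le) (by positivity))

/-- `0 ≤ c₀(δ₀, α)ᵈ` (the Lemma 2.1 [3] constant of the cube geometry). [cite: Balaban1984PropagatorsII, Lemma 2.1 (2.61) p.234] -/
private theorem c0_pow_nonneg (δ₀ α : ℝ) (d : ℕ) : 0 ≤ B6.c0 δ₀ α ^ d :=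
  pow_nonneg (tsum_nonneg fun _ => (Real.exp_pos _).le) d

/-! ## §1 (1.42) at the concrete `C_{j+1}`: the tower field of `ℍ_{j+1,□′}` on the coarse bonds `T`, sup output size -/

section Eq142

variable {𝔸 : Type} [NormedRing 𝔸] [NormedAlgebra ℂ 𝔸] [CompleteSpace 𝔸] [NormOneClass 𝔸]

variable (L : ℕ) (hL : 2 ≤ L) {G : Subgroup 𝔸ˣ} (hAG : AvgClosed d L G) (k₁ : ℕ)
  (U₁ : B7Prop1Explicit.Site d → Fin d → 𝔸ˣ) (hU₁ : ∀ x κ, U₁ x κ ∈ G) {α₁ : ℝ} (hα₁ : 0 < α₁)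
  (hα₁3 : C0 d * α₁ ≤ 1 / 3) (hα₁4 : 4 * α₁ ≤ c2' d L) (h52₁ : pdev U₁ < α₁ * (((L : ℝ) ^ k₁)⁻¹) ^ 2)
  {b₁ : ℝ} (hb₁ : 0 < b₁)
  (hsmall₁ : Real.exp (4 * (800 * ((d : ℝ) + 1) ^ 2 * ((d : ℝ) + 4)) * α₁)
    * (1 + 8 * (131072 * ((d : ℝ) + 1) ^ 2) * ((L : ℝ) ^ k₁ * b₁)) ≤ 2)
  (hc₃₁ : 4 * ((L : ℝ) ^ k₁ * b₁) < c3 d L)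
  (h145₁ : 8 * d * thetaGen d L α₁ * (L : ℝ)⁻¹ ^ 4 ≤ 1)
  (h155₁ : (2 * (L : ℝ) - 1) * (L : ℝ)⁻¹ ^ 2 + 2 * d * thetaGen d L α₁ * (L : ℝ)⁻¹ ^ 3
    + 1 / 8 * (1 + 2 * d * thetaGen d L α₁ * (L : ℝ)⁻¹ ^ 2 + 2 * d * C3Gen d L * ((L : ℝ) ^ k₁ * b₁)) * (L : ℝ)⁻¹ ^ 2 ≤ 1)
  (S T : Finset (B7Prop1Explicit.Site d × Fin d))

variable {𝒵 : Type} [NormedAddCommGroup 𝒵] [NormedSpace ℂ 𝒵] [CompleteSpace 𝒵]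
  {𝒢 : 𝒵 →L[ℂ] (S → 𝔸)} {W : (S → 𝔸) → 𝒵} {D2 : (S → 𝔸) →L[ℂ] 𝒵} {H₀ : (T → 𝔸) →L[ℂ] (S → 𝔸)} {B₀ θ C₄ a₃ 𝔧 𝔞 ε₄ : ℝ}

include hL hAG hU₁ hα₁ hα₁3 hα₁4 h52₁ hb₁ hsmall₁ hc₃₁ h145₁ h155₁ in
/-- **(1.42) «≦ ½δ_j» ON THE LATTICE MODEL, AT THE CONCRETE `C_{j+1}(U₁, ·)` OF [4] ON THE SINGLE-SCALE CUBE GEOMETRY** — r12's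
`B15From190LayerSizes.ineq142_le_half_of_ineq190_layer` (argument field `B :=` the (1.30)-type tower field of `ℍ_{j+1,□′}`, `j + 1` levels,
INDEXED BY THE COARSE BONDS `T` of the scheme, so that the scheme's `B`-space is `𝔸^T`; input size = the sup size of the coarse bonds of the cube
geometry `supSize (cubeGeometry L (j+1) S T) boxT blkT`; output size `supSize … box blk` — *"bounded on □′^{∼2}"*) for the presented chart
`ℍ = x ↦ ev x (𝓗(B))`, `𝓗 = chartH179 𝒢 W D2 H₀ (· − H(Dfix(C_{j+1}(U₁,·)) ·)) ε₄` ([15] (179) with the Sect. C selector `D = Dfix` = the solution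
of (49) for the concrete remainder `C_{j+1}(U₁, ·) = B11Eq44Concrete.Cmap L U₁ S T (j+1)`), with the pair `h190`/`hmv` SUPPLIED BY NAME from r08
g11's `B11Ineq73HasMajConcrete.ineq190_and_hmv_supSize_concreteC_kernel` — hence WITH (190) ITSELF, the mean-value reading, the (73) majorant of
the actual derivative of `Dfix` (from the H-kernel letter `hHker`), [3] (2.54) (`ℓ¹` triangle inequality of the cubes), Lemma 2.1 (2.61) at the
rate `⅛δ₀` (constant `c₀(δ₀,⅛)ᵈ`) and the letters `hN`/`hBloc` ALL DISCHARGED; the knit's own row sum [3] (2.61) at the rate `σ = αδ₀`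
(`σ + τ ≤ ⅛δ₀`) is `rowSum_cubeGeometry` (constant `c₀(δ₀,α)ᵈ`), its `hdist` is `dist_nonneg_cubeGeometry`.  Remaining: the located leaves
of [15] Sect. G for the ABSTRACT data `G̃`, `Δ⁽²⁾H₀`, `H₀`, `H` on the cube sizes ((189) `h189`, kernel letters `hG190`/`hD2H0`/`hH0`/`hH`,
`q_G < 1`), the H-kernel letter `hHker` with its smallness `hq`, the Sect. G `Regime`, `W`-analyticity, (46), the Prop. 3 smallness in tree
units, the [4] regime of the background `U₁` of `C_{j+1}` (kept distinct from the tower's fine field `U₀`: instantiate `U₁ := U₀` for print's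
single configuration), the (115)-presentation letter `hev`, and the knit's side conditions verbatim (`δLM₂R_{j+1} ≤ τD`, (1.24) at `j + 1`,
`h15`, `hX`/`hfar`/`hbox`, the flow/γ-clauses).
[cite: Balaban1989LargeFieldI, (1.40)–(1.42) p.185; Balaban1985Variational, Prop. 9 (190) pp.308–309, (179)–(180) p.306, (73) p.289, Prop. 3 p.289; Balaban1984PropagatorsII, Lemma 2.1 (2.61) p.234, (2.54) p.233] -/
theorem ineq142_le_half_layer_concreteC {j : ℕ} (hj : j + 1 ≤ k₁) (hd1 : 1 ≤ d)
    (Reg : Regime 𝒢 0 W B₀ θ C₄ a₃ 𝔧 𝔞 ε₄) (hWa : AnalyticOnNhd ℂ W {Y : S → 𝔸 | ‖Y‖ < a₃})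
    (H : (T → 𝔸) →L[ℂ] (S → 𝔸)) {B₀' : ℝ} (hB₀' : 0 ≤ B₀') (hH46 : ∀ X, ‖H X‖ ≤ B₀' * ‖X‖)
    {c1h ε₃ : ℝ} (hc1h : 1 ≤ c1h) (hε₃ : 0 < ε₃)
    (h18 : 18 * ((8 * (131072 * ((d : ℝ) + 1) ^ 2) * Real.exp (4 * (800 * ((d : ℝ) + 1) ^ 2 * ((d : ℝ) + 4)) * α₁)) *
      ((L : ℝ) ^ (j + 1)) ^ 2) * B₀' * d * c1h * ε₃ ≤ 1) (h2 : 2 * ε₃ ≤ b₁ / 2) (hnest : ε₄ + 𝔞 ≤ ε₃)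
    {δ₀ B₁ : ℝ} (hδ₀ : 0 < δ₀) (hB₁ : 0 ≤ B₁)
    (hHker : ∀ (c'' : T) (Y : 𝔸) (s : S),
      ‖H (Pi.single c'' Y) s‖ ≤ B₁ * Real.exp (-(δ₀ * ((B7Prop1Explicit.l1 (loK L (j + 1) c''.1.1 - s.1.1) : ℝ) / (L : ℝ) ^ (j + 1)))) * ‖Y‖)
    (hq : (C3Gen d L * (((L : ℝ) ^ (j + 1)) ^ 2 * (2 * ε₃)) * (2 * d) * B₁ * Real.exp (2 * d * δ₀)) * (d * B6.c0 δ₀ (1 / 2) ^ d) < 1)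
    -- the (1.30)-type tower of `ℍ_{j+1,□′}` (fine field `U₀`), indexed by the coarse bonds `T`; its field in the domain of (180)
    (dep : T → ℕ) (pt : T → B7Prop1Explicit.Site d) (dir : T → Fin d)
    {U₀ : B7Prop1Explicit.Site d → Fin d → 𝔸ˣ} (hU₀ : ∀ x κ, U₀ x κ ∈ G)
    (hB : ‖H₀ (fun i => mlog (((avgIter L U₀ (j + 1 - dep i) (pt i) (dir i) *
          (pullIter L (avgIter L U₀ (j + 1)) (dep i) (pt i) (dir i))⁻¹ : 𝔸ˣ) : 𝔸)))‖ < 𝔞 ∧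
      ‖D2 (H₀ (fun i => mlog (((avgIter L U₀ (j + 1 - dep i) (pt i) (dir i) *
          (pullIter L (avgIter L U₀ (j + 1)) (dep i) (pt i) (dir i))⁻¹ : 𝔸ˣ) : 𝔸))))‖ < 𝔧)
    -- the output presentation on the cube geometry
    (box : (cubeGeometry L (j + 1) S T).Site → Finset (B7Prop1Explicit.Site d))
    (blk : B7Prop1Explicit.Site d → (cubeGeometry L (j + 1) S T).Site)
    (ev : B7Prop1Explicit.Site d → ((S → 𝔸) →L[ℝ] (Fin d → 𝔸))) {b3 : BlockNorm (cubeGeometry L (j + 1) S T) 𝒵}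
    (hev : ∀ (y : (cubeGeometry L (j + 1) S T).Site) (v : S → 𝔸), ∀ x ∈ box y,
      ‖ev x v‖ ≤ (supSize (cubeGeometry L (j + 1) S T) (boxS L (j + 1) S T) (blkS L (j + 1) S T) :
        BlockNorm (cubeGeometry L (j + 1) S T) (S → 𝔸)).loc y v)
    -- the located leaves of [15] Sect. G for the abstract data on the cube sizes
    {BG θW cΔ A₀ AH : ℝ} (hBG : 0 ≤ BG) (hθW : 0 ≤ θW) (hcΔ : 0 ≤ cΔ) (hA₀ : 0 ≤ A₀) (hAH : 0 ≤ AH)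
    (hG190 : HasMaj b3 (supSize (cubeGeometry L (j + 1) S T) (boxS L (j + 1) S T) (blkS L (j + 1) S T) :
        BlockNorm (cubeGeometry L (j + 1) S T) (S → 𝔸))
      (𝒢.restrictScalars ℝ : 𝒵 →ₗ[ℝ] (S → 𝔸)) (fun y y' => BG * Real.exp (-(δ₀ * (cubeGeometry L (j + 1) S T).dist y y'))))
    (hD2H0 : HasMaj (supSize (cubeGeometry L (j + 1) S T) (boxT L (j + 1) S T) (blkT L (j + 1) S T) :
        BlockNorm (cubeGeometry L (j + 1) S T) (T → 𝔸)) b3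
      ((D2 ∘L H₀).restrictScalars ℝ : (T → 𝔸) →ₗ[ℝ] 𝒵) (fun y y' => cΔ * Real.exp (-(δ₀ * (cubeGeometry L (j + 1) S T).dist y y'))))
    (hH0 : HasMaj (supSize (cubeGeometry L (j + 1) S T) (boxT L (j + 1) S T) (blkT L (j + 1) S T) :
        BlockNorm (cubeGeometry L (j + 1) S T) (T → 𝔸))
      (supSize (cubeGeometry L (j + 1) S T) (boxS L (j + 1) S T) (blkS L (j + 1) S T) :
        BlockNorm (cubeGeometry L (j + 1) S T) (S → 𝔸))
      (H₀.restrictScalars ℝ : (T → 𝔸) →ₗ[ℝ] (S → 𝔸)) (fun y y' => A₀ * Real.exp (-(δ₀ * (cubeGeometry L (j + 1) S T).dist y y'))))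
    (hH : HasMaj (supSize (cubeGeometry L (j + 1) S T) (boxT L (j + 1) S T) (blkT L (j + 1) S T) :
        BlockNorm (cubeGeometry L (j + 1) S T) (T → 𝔸))
      (supSize (cubeGeometry L (j + 1) S T) (boxS L (j + 1) S T) (blkS L (j + 1) S T) :
        BlockNorm (cubeGeometry L (j + 1) S T) (S → 𝔸))
      (H.restrictScalars ℝ : (T → 𝔸) →ₗ[ℝ] (S → 𝔸)) (fun y y' => AH * Real.exp (-(δ₀ / 2 * (cubeGeometry L (j + 1) S T).dist y y'))))
    (h189 : ∀ B' : T → 𝔸, ‖H₀ B'‖ < 𝔞 → ‖D2 (H₀ B')‖ < 𝔧 →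
      Ineq189 (supSize (cubeGeometry L (j + 1) S T) (boxS L (j + 1) S T) (blkS L (j + 1) S T) :
          BlockNorm (cubeGeometry L (j + 1) S T) (S → 𝔸)) b3
        ((fderiv ℂ W (solA180 𝒢 W D2 H₀ ε₄ B' + H₀ B')).restrictScalars ℝ : (S → 𝔸) →ₗ[ℝ] 𝒵) θW δ₀)
    (hqG : qG b3.κ 1 BG θW (B6.c0 δ₀ (1 / 8) ^ d) < 1)
    -- the [IV] side: the letters of `B15From190LayerSizes.ineq142_le_half_of_ineq190_layer` minus `h190`, `hmv`, `hdist`, `hrow`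
    {α τ Dd : ℝ} (hσ : 0 < α) (hτ : 0 ≤ τ) (hστ : α * δ₀ + τ ≤ δ₀ / 8) (y : (cubeGeometry L (j + 1) S T).Site)
    {B₃ δ M₂ β₀ A₀' A₁ εj εj1 δj γ gj1 β : ℝ} {R r : ℕ}
    (hβ : 0 ≤ β) (hε' : 0 < εj1) (hε3 : C0 d * εj1 ≤ 1 / 3) (hε2 : 2 * εj1 ≤ c2' d L)
    (hεs : 11 * (d : ℝ) ^ 2 * εj1 ≤ 1 / 6) (lo hi : B7Prop1Explicit.Site d) (hlohi : lo ≤ hi)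
    (h124 : pdevOn (tlo L lo (j + 1)) (thi L hi (j + 1)) U₀ < (1 - β * (1 / 2)) * εj1 * (((L : ℝ) ^ (j + 1))⁻¹) ^ 2)
    (h15 : ∀ n, n < j + 1 → ∀ z, tlo L lo n ≤ z → z ≤ thi L hi n → ∀ r : Fin d → Fin L,
      axialFn (avgIter L U₀ (j + 1 - (n + 1))) ((L : ℤ) • z) ((L : ℤ) • z + boxVec L r) = 1)
    (hX : ∀ i, dep i ≤ j + 1 ∧ tlo L lo (dep i) ≤ pt i ∧ pt i + e (dir i) ≤ thi L hi (dep i))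
    (hfar : ∀ y' i, i ∈ boxT L (j + 1) S T y' → Dd ≤ (cubeGeometry L (j + 1) S T).dist y y')
    {Hf : B7Prop1Explicit.Site d → Fin d → 𝔸}
    (hHf : Hf = fun x => ev x (chartH179 𝒢 W D2 H₀
      (fun Y : S → 𝔸 => Y - H (Dfix (B11Eq44Concrete.Cmap L U₁ S T (j + 1)) (H : (T → 𝔸) →ₗ[ℂ] (S → 𝔸))
        ((8 * (131072 * ((d : ℝ) + 1) ^ 2) * Real.exp (4 * (800 * ((d : ℝ) + 1) ^ 2 * ((d : ℝ) + 4)) * α₁)) *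
          ((L : ℝ) ^ (j + 1)) ^ 2) Y)) ε₄
      (fun i => mlog (((avgIter L U₀ (j + 1 - dep i) (pt i) (dir i) *
          (pullIter L (avgIter L U₀ (j + 1)) (dep i) (pt i) (dir i))⁻¹ : 𝔸ˣ) : 𝔸)))))
    {α₀ : ℝ} (hα : 0 < α₀) (hα3 : C0 d * α₀ ≤ 1 / 3) (hα4 : 4 * α₀ ≤ c2' d L)
    (h52 : pdev U₀ < α₀ * (((L : ℝ) ^ j)⁻¹) ^ 2) (q : B7Prop1Explicit.Site d) (κ : Fin d)
    (hgeom : δ * L * M₂ * R ≤ τ * Dd)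
    (hCB : const190 1 1 b3.κ BG θW cΔ A₀ AH
        (d * Real.exp (1 / 2 * d * δ₀) *
          ((1 - (C3Gen d L * (((L : ℝ) ^ (j + 1)) ^ 2 * (2 * ε₃)) * (2 * d) * B₁ * Real.exp (2 * d * δ₀)) *
              (d * B6.c0 δ₀ (1 / 2) ^ d))⁻¹ * (Real.exp (d * δ₀) * (C3Gen d L * ((L : ℝ) ^ (j + 1)) ^ 2 * (2 * ε₃)))))
        (B6.c0 δ₀ (1 / 8) ^ d) * B6.c0 δ₀ α ^ d ≤ B₃) (hB₃ : 0 ≤ B₃)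
    (hbox : ∀ y', B7Prop1Local.InBox (B7Prop1Local.loK L j q) (B7Prop1Local.bondHiK L j q κ) y' → y' ∈ box y)
    (hflow : εj1 ≤ (1 + β₀) * εj) (hεδ : εj = A₀' / A₁ * δj) (hL1 : 1 ≤ L)
    (hr : 1 ≤ r) (hR : B14.IsRj L r gj1 R) (hgr : 0 < gj1) (hgγ : gj1 ≤ γ) (hγe : 1 ≤ Real.log (γ ^ 2)⁻¹)
    (hc1 : 1 ≤ δ * L * M₂) (hβ₀ : 0 ≤ 1 + β₀) (hA : 0 ≤ A₀' / A₁) (hδj : 0 ≤ δj)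
    (hγ : (68 * ((d : ℝ) + 1) + 160 * d) * B₃ * (22 * d ^ 2) * (1 + β₀) * (A₀' / A₁) * γ ^ 2 ≤ 1 / 2)
    (hεj1 : εj ≤ 1)
    (hsmγ : 2048 * (d : ℝ) * (B₃ * (22 * (d : ℝ) ^ 2) * (1 + β₀) * γ ^ 2) ≤ 1)
    (hc₃γ : 2 * (B₃ * (22 * (d : ℝ) ^ 2) * (1 + β₀) * γ ^ 2) ≤ c3 d L)
    (hsmallγ : Real.exp (4 * (800 * ((d : ℝ) + 1) ^ 2 * ((d : ℝ) + 4)) * α₀)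
      * (1 + 8 * (131072 * ((d : ℝ) + 1) ^ 2) * (B₃ * (22 * (d : ℝ) ^ 2) * (1 + β₀) * γ ^ 2)) ≤ 2) :
    ‖((avgIter L
          (gaugeAct (B7Eq84Concrete.glev L hL1 U₀
              (expCfg (fun y μ => ((Complex.I : ℂ) * ((((L : ℝ) ^ (j + 1))⁻¹ : ℝ) : ℂ)) • Hf y μ)) j 0)⁻¹
            (expCfg (fun y μ => ((Complex.I : ℂ) * ((((L : ℝ) ^ (j + 1))⁻¹ : ℝ) : ℂ)) • Hf y μ) * U₀)) j q κ : 𝔸ˣ) : 𝔸)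
        * (((avgIter L U₀ j q κ)⁻¹ : 𝔸ˣ) : 𝔸) - 1‖ ≤ δj / 2 := by
  obtain ⟨h190, hmv⟩ := ineq190_and_hmv_supSize_concreteC_kernel L hL hAG k₁ U₁ hU₁ hα₁ hα₁3 hα₁4 h52₁ hb₁ hsmall₁ hc₃₁
    h145₁ h155₁ S T hj hd1 Reg hWa H hB₀' hH46 hc1h hε₃ h18 h2 hnest hδ₀ hB₁ hHker hq hB ev hev hBG hθW hcΔ hA₀ hAH hG190
    hD2H0 hH0 hH h189 hqG
    (fun B' => fun x => ev x (chartH179 𝒢 W D2 H₀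
      (fun Y : S → 𝔸 => Y - H (Dfix (B11Eq44Concrete.Cmap L U₁ S T (j + 1)) (H : (T → 𝔸) →ₗ[ℂ] (S → 𝔸))
        ((8 * (131072 * ((d : ℝ) + 1) ^ 2) * Real.exp (4 * (800 * ((d : ℝ) + 1) ^ 2 * ((d : ℝ) + 4)) * α₁)) *
          ((L : ℝ) ^ (j + 1)) ^ 2) Y)) ε₄ B'))
    (fun t => (LinearMap.pi fun x => ((ev x : (S → 𝔸) →L[ℝ] (Fin d → 𝔸)) : (S → 𝔸) →ₗ[ℝ] (Fin d → 𝔸))) ∘ₗ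
      ((fderiv ℂ (chartH179 𝒢 W D2 H₀
        (fun Y : S → 𝔸 => Y - H (Dfix (B11Eq44Concrete.Cmap L U₁ S T (j + 1)) (H : (T → 𝔸) →ₗ[ℂ] (S → 𝔸))
          ((8 * (131072 * ((d : ℝ) + 1) ^ 2) * Real.exp (4 * (800 * ((d : ℝ) + 1) ^ 2 * ((d : ℝ) + 4)) * α₁)) *
            ((L : ℝ) ^ (j + 1)) ^ 2) Y)) ε₄)
        ((t : ℝ) • (fun i => mlog (((avgIter L U₀ (j + 1 - dep i) (pt i) (dir i) *
          (pullIter L (avgIter L U₀ (j + 1)) (dep i) (pt i) (dir i))⁻¹ : 𝔸ˣ) : 𝔸))))).restrictScalars ℝ :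
            (T → 𝔸) →ₗ[ℝ] (S → 𝔸)))
    (fun _ => rfl) (fun _ => rfl) y
  have hK : 0 ≤ const190 1 1 b3.κ BG θW cΔ A₀ AH
      (d * Real.exp (1 / 2 * d * δ₀) *
        ((1 - (C3Gen d L * (((L : ℝ) ^ (j + 1)) ^ 2 * (2 * ε₃)) * (2 * d) * B₁ * Real.exp (2 * d * δ₀)) *
            (d * B6.c0 δ₀ (1 / 2) ^ d))⁻¹ * (Real.exp (d * δ₀) * (C3Gen d L * ((L : ℝ) ^ (j + 1)) ^ 2 * (2 * ε₃)))))
      (B6.c0 δ₀ (1 / 8) ^ d) :=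
    const190_nonneg' zero_le_one zero_le_one b3.κ_nonneg (c0_pow_nonneg δ₀ (1 / 8) d) hBG hθW hcΔ hA₀ hAH
      (thetaD_nonneg hε₃.le hq) hqG
  have hrow : RowSum (cubeGeometry L (j + 1) S T) (α * δ₀) (B6.c0 δ₀ α ^ d) :=
    rowSum_cubeGeometry L (j + 1) S T (mul_pos hσ hδ₀)
  subst hHf
  exact ineq142_le_half_of_ineq190_layer (boxT L (j + 1) S T) (blkT L (j + 1) S T) dep pt dir box blk h190 hK
    (dist_nonneg_cubeGeometry L (j + 1) S T) hrow hτ hστ y hL hd1 hAG hU₀ hβ hε' hε3 hε2 hεs lo hi hlohi h124 h15 hX hfar hmv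
    hα hα3 hα4 h52 q κ hgeom hCB hB₃ hbox hflow hεδ hL1 hr hR hgr hgγ hγe hc1 hβ₀ hA hδj hγ hεj1 hsmγ hc₃γ hsmallγ

end Eq142

/-! ## §2 (1.37)–(1.39) at the concrete `C_j`: print's two regions / three pieces of the (1.34) argument field on the coarse bonds `T` -/

section Eq139

variable {𝔸 : Type} [NormedRing 𝔸] [NormedAlgebra ℂ 𝔸] [CompleteSpace 𝔸] [NormOneClass 𝔸]

variable (L : ℕ) (hL : 2 ≤ L) {G : Subgroup 𝔸ˣ} (hAG : AvgClosed d L G) (k₁ : ℕ)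
  (U₁ : B7Prop1Explicit.Site d → Fin d → 𝔸ˣ) (hU₁ : ∀ x κ, U₁ x κ ∈ G) {α₁ : ℝ} (hα₁ : 0 < α₁)
  (hα₁3 : C0 d * α₁ ≤ 1 / 3) (hα₁4 : 4 * α₁ ≤ c2' d L) (h52₁ : pdev U₁ < α₁ * (((L : ℝ) ^ k₁)⁻¹) ^ 2)
  {b₁ : ℝ} (hb₁ : 0 < b₁)
  (hsmall₁ : Real.exp (4 * (800 * ((d : ℝ) + 1) ^ 2 * ((d : ℝ) + 4)) * α₁)
    * (1 + 8 * (131072 * ((d : ℝ) + 1) ^ 2) * ((L : ℝ) ^ k₁ * b₁)) ≤ 2)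
  (hc₃₁ : 4 * ((L : ℝ) ^ k₁ * b₁) < c3 d L)
  (h145₁ : 8 * d * thetaGen d L α₁ * (L : ℝ)⁻¹ ^ 4 ≤ 1)
  (h155₁ : (2 * (L : ℝ) - 1) * (L : ℝ)⁻¹ ^ 2 + 2 * d * thetaGen d L α₁ * (L : ℝ)⁻¹ ^ 3
    + 1 / 8 * (1 + 2 * d * thetaGen d L α₁ * (L : ℝ)⁻¹ ^ 2 + 2 * d * C3Gen d L * ((L : ℝ) ^ k₁ * b₁)) * (L : ℝ)⁻¹ ^ 2 ≤ 1)
  (S T : Finset (B7Prop1Explicit.Site d × Fin d))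

variable {𝒵 : Type} [NormedAddCommGroup 𝒵] [NormedSpace ℂ 𝒵] [CompleteSpace 𝒵]
  {𝒢 : 𝒵 →L[ℂ] (S → 𝔸)} {W : (S → 𝔸) → 𝒵} {D2 : (S → 𝔸) →L[ℂ] 𝒵} {H₀ : (T → 𝔸) →L[ℂ] (S → 𝔸)} {B₀ θ C₄ a₃ 𝔧 𝔞 ε₄ : ℝ}

include hL hAG hU₁ hα₁ hα₁3 hα₁4 h52₁ hb₁ hsmall₁ hc₃₁ h145₁ h155₁ in
/-- **p. 185 «lhs of (1.37) ≤ ½δ_j» ON THE LATTICE MODEL, AT THE CONCRETE `C_j(U₁, ·)` OF [4] ON THE SINGLE-SCALE CUBE GEOMETRY** — r12's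
`B15From190LayerSizes.ineq139_half_of_ineq190_layer` (the (1.34) argument field on ONE finite bond index set carrying print's two regions, tag
`rg` — `rg i = true` = the `Ω_{j+1}∩Z_{j+1}` tower of `j + 1` levels, *"equal to 0 … bounded by 22d²ε_{j+1}"*; `rg i = false` = the
`Ω^c_{j+1}∩Z^c_j` tower of `j` levels with top field `V = V_j`, *"equal to (1/i)log[V_j(V_Z^{(j)})⁻¹], hence … 4δ′_j … On the boundary layer …
22d²ε_j"* —, HERE INDEXED BY THE COARSE BONDS `T` of the scheme; the three B-sizes and two localisations discharged there; input size = the sup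
size of the coarse bonds of the cube geometry at scale `j`, output size `supSize … box blk`) for the presented chart `ℍ = x ↦ ev x (𝓗(B))`,
`𝓗 = chartH179 𝒢 W D2 H₀ (· − H(Dfix(C_j(U₁,·)) ·)) ε₄`, with `h190`/`hmv` SUPPLIED BY NAME from r08's
`B11Ineq73HasMajConcrete.ineq190_and_hmv_supSize_concreteC_kernel` ((190), mean value, (73), (2.54), (2.61) at `⅛δ₀`, `hN`/`hBloc` DISCHARGED); the
knit's row sum at the rate `σ = αδ₀` is `rowSum_cubeGeometry`, `hdist` is `dist_nonneg_cubeGeometry`; the STRICT weight `const190·c₀(δ₀,α)ᵈ < B₃`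
as in the layer knit.  Remaining: as in §1 (abstract `G̃`/`Δ⁽²⁾H₀`/`H₀`/`H` letters on the cube sizes, (189), `q_G < 1`, `hHker` + `hq`, `Regime`,
`W`-analyticity, (46), Prop. 3 smallness, the [4] regime of `U₁`, `hev`) and the knit's side conditions verbatim ((1.24) on both finest cubes,
(1.27) `h127`, `6δ′_j ≤ ε_j`, `hfar₂`/`hfar₃` = *"R_{j+1}M"* / *"6LMR_{j+1}"* in the cube distance, the (1.38) profile letters and γ-clauses).
[cite: Balaban1989LargeFieldI, (1.34)–(1.39) pp.184–185, (1.27) p.182; Balaban1985Variational, Prop. 9 (190) pp.308–309, (179)–(180) p.306, (73) p.289, Prop. 3 p.289; Balaban1984PropagatorsII, Lemma 2.1 (2.61) p.234, (2.54) p.233] -/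
theorem ineq139_half_layer_concreteC {j : ℕ} (hj : j ≤ k₁) (hd1 : 1 ≤ d)
    (Reg : Regime 𝒢 0 W B₀ θ C₄ a₃ 𝔧 𝔞 ε₄) (hWa : AnalyticOnNhd ℂ W {Y : S → 𝔸 | ‖Y‖ < a₃})
    (H : (T → 𝔸) →L[ℂ] (S → 𝔸)) {B₀' : ℝ} (hB₀' : 0 ≤ B₀') (hH46 : ∀ X, ‖H X‖ ≤ B₀' * ‖X‖)
    {c1h ε₃ : ℝ} (hc1h : 1 ≤ c1h) (hε₃ : 0 < ε₃)
    (h18 : 18 * ((8 * (131072 * ((d : ℝ) + 1) ^ 2) * Real.exp (4 * (800 * ((d : ℝ) + 1) ^ 2 * ((d : ℝ) + 4)) * α₁)) *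
      ((L : ℝ) ^ j) ^ 2) * B₀' * d * c1h * ε₃ ≤ 1) (h2 : 2 * ε₃ ≤ b₁ / 2) (hnest : ε₄ + 𝔞 ≤ ε₃)
    {δ₀ B₁ : ℝ} (hδ₀ : 0 < δ₀) (hB₁ : 0 ≤ B₁)
    (hHker : ∀ (c'' : T) (Y : 𝔸) (s : S),
      ‖H (Pi.single c'' Y) s‖ ≤ B₁ * Real.exp (-(δ₀ * ((B7Prop1Explicit.l1 (loK L j c''.1.1 - s.1.1) : ℝ) / (L : ℝ) ^ j))) * ‖Y‖)
    (hq : (C3Gen d L * (((L : ℝ) ^ j) ^ 2 * (2 * ε₃)) * (2 * d) * B₁ * Real.exp (2 * d * δ₀)) * (d * B6.c0 δ₀ (1 / 2) ^ d) < 1)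
    -- the two towers (region tag `rg`) on the coarse bonds `T`, fine field `U₀` shared, top field `V` of the second region
    (rg : T → Bool) (dep : T → ℕ) (pt : T → B7Prop1Explicit.Site d) (dir : T → Fin d)
    {U₀ : B7Prop1Explicit.Site d → Fin d → 𝔸ˣ} (hU₀ : ∀ x κ, U₀ x κ ∈ G) (V : B7Prop1Explicit.Site d → Fin d → 𝔸ˣ)
    (hB : ‖H₀ (fun i => if rg i then
            mlog (((avgIter L U₀ (j + 1 - dep i) (pt i) (dir i) *
              (pullIter L (avgIter L U₀ (j + 1)) (dep i) (pt i) (dir i))⁻¹ : 𝔸ˣ) : 𝔸))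
          else
            mlog (((pullIter L V (dep i) (pt i) (dir i) *
              (avgIter L U₀ (j - dep i) (pt i) (dir i))⁻¹ : 𝔸ˣ) : 𝔸)))‖ < 𝔞 ∧
      ‖D2 (H₀ (fun i => if rg i then
            mlog (((avgIter L U₀ (j + 1 - dep i) (pt i) (dir i) *
              (pullIter L (avgIter L U₀ (j + 1)) (dep i) (pt i) (dir i))⁻¹ : 𝔸ˣ) : 𝔸))
          else
            mlog (((pullIter L V (dep i) (pt i) (dir i) *
              (avgIter L U₀ (j - dep i) (pt i) (dir i))⁻¹ : 𝔸ˣ) : 𝔸))))‖ < 𝔧)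
    -- the output presentation on the cube geometry
    (box : (cubeGeometry L j S T).Site → Finset (B7Prop1Explicit.Site d))
    (blk : B7Prop1Explicit.Site d → (cubeGeometry L j S T).Site)
    (ev : B7Prop1Explicit.Site d → ((S → 𝔸) →L[ℝ] (Fin d → 𝔸))) {b3 : BlockNorm (cubeGeometry L j S T) 𝒵}
    (hev : ∀ (y : (cubeGeometry L j S T).Site) (v : S → 𝔸), ∀ x ∈ box y,
      ‖ev x v‖ ≤ (supSize (cubeGeometry L j S T) (boxS L j S T) (blkS L j S T) : BlockNorm (cubeGeometry L j S T) (S → 𝔸)).loc y v)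
    -- the located leaves of [15] Sect. G for the abstract data on the cube sizes
    {BG θW cΔ A₀ AH : ℝ} (hBG : 0 ≤ BG) (hθW : 0 ≤ θW) (hcΔ : 0 ≤ cΔ) (hA₀ : 0 ≤ A₀) (hAH : 0 ≤ AH)
    (hG190 : HasMaj b3 (supSize (cubeGeometry L j S T) (boxS L j S T) (blkS L j S T) : BlockNorm (cubeGeometry L j S T) (S → 𝔸))
      (𝒢.restrictScalars ℝ : 𝒵 →ₗ[ℝ] (S → 𝔸)) (fun y y' => BG * Real.exp (-(δ₀ * (cubeGeometry L j S T).dist y y'))))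
    (hD2H0 : HasMaj (supSize (cubeGeometry L j S T) (boxT L j S T) (blkT L j S T) : BlockNorm (cubeGeometry L j S T) (T → 𝔸)) b3
      ((D2 ∘L H₀).restrictScalars ℝ : (T → 𝔸) →ₗ[ℝ] 𝒵) (fun y y' => cΔ * Real.exp (-(δ₀ * (cubeGeometry L j S T).dist y y'))))
    (hH0 : HasMaj (supSize (cubeGeometry L j S T) (boxT L j S T) (blkT L j S T) : BlockNorm (cubeGeometry L j S T) (T → 𝔸))
      (supSize (cubeGeometry L j S T) (boxS L j S T) (blkS L j S T) : BlockNorm (cubeGeometry L j S T) (S → 𝔸))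
      (H₀.restrictScalars ℝ : (T → 𝔸) →ₗ[ℝ] (S → 𝔸)) (fun y y' => A₀ * Real.exp (-(δ₀ * (cubeGeometry L j S T).dist y y'))))
    (hH : HasMaj (supSize (cubeGeometry L j S T) (boxT L j S T) (blkT L j S T) : BlockNorm (cubeGeometry L j S T) (T → 𝔸))
      (supSize (cubeGeometry L j S T) (boxS L j S T) (blkS L j S T) : BlockNorm (cubeGeometry L j S T) (S → 𝔸))
      (H.restrictScalars ℝ : (T → 𝔸) →ₗ[ℝ] (S → 𝔸)) (fun y y' => AH * Real.exp (-(δ₀ / 2 * (cubeGeometry L j S T).dist y y'))))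
    (h189 : ∀ B' : T → 𝔸, ‖H₀ B'‖ < 𝔞 → ‖D2 (H₀ B')‖ < 𝔧 →
      Ineq189 (supSize (cubeGeometry L j S T) (boxS L j S T) (blkS L j S T) : BlockNorm (cubeGeometry L j S T) (S → 𝔸)) b3
        ((fderiv ℂ W (solA180 𝒢 W D2 H₀ ε₄ B' + H₀ B')).restrictScalars ℝ : (S → 𝔸) →ₗ[ℝ] 𝒵) θW δ₀)
    (hqG : qG b3.κ 1 BG θW (B6.c0 δ₀ (1 / 8) ^ d) < 1)
    -- the [IV] side: the letters of `B15From190LayerSizes.ineq139_half_of_ineq190_layer` minus `h190`, `hmv`, `hdist`, `hrow`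
    {α τ : ℝ} (hσ : 0 < α) (hτ : 0 ≤ τ) (hστ : α * δ₀ + τ ≤ δ₀ / 8) (y : (cubeGeometry L j S T).Site)
    {B₃ δ'j M εj εj1 β₀ A₀' A₁ δj γ gj gj1 β : ℝ} {R r p₀ p₁ : ℕ}
    (hβ : 0 ≤ β) (hε1' : 0 < εj1) (hε3' : C0 d * εj1 ≤ 1 / 3) (hε2' : 2 * εj1 ≤ c2' d L)
    (hεs' : 11 * (d : ℝ) ^ 2 * εj1 ≤ 1 / 6) (lo₁ hi₁ : B7Prop1Explicit.Site d) (hlohi₁ : lo₁ ≤ hi₁)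
    (h124₁ : pdevOn (tlo L lo₁ (j + 1)) (thi L hi₁ (j + 1)) U₀ < (1 - β * (1 / 2)) * εj1 * (((L : ℝ) ^ (j + 1))⁻¹) ^ 2)
    (h15₁ : ∀ n, n < j + 1 → ∀ z, tlo L lo₁ n ≤ z → z ≤ thi L hi₁ n → ∀ r : Fin d → Fin L,
      axialFn (avgIter L U₀ (j + 1 - (n + 1))) ((L : ℤ) • z) ((L : ℤ) • z + boxVec L r) = 1)
    (hX₁ : ∀ i, rg i = true → dep i ≤ j + 1 ∧ tlo L lo₁ (dep i) ≤ pt i ∧ pt i + e (dir i) ≤ thi L hi₁ (dep i))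
    (hε : 0 < εj) (hε3 : C0 d * εj ≤ 1 / 3) (hε2 : 2 * εj ≤ c2' d L) (lo₂ hi₂ : B7Prop1Explicit.Site d) (hlohi₂ : lo₂ ≤ hi₂)
    (h124₂ : pdevOn (tlo L lo₂ j) (thi L hi₂ j) U₀ < εj * (((L : ℝ) ^ j)⁻¹) ^ 2)
    (hV : ∀ x μ, V x μ ∈ U1 𝔸) (hδ0 : 0 ≤ δ'j) (hδε : 6 * δ'j ≤ εj)
    (hs : 2 * δ'j + 11 * (d : ℝ) ^ 2 * εj ≤ 1 / 6) (hδ2 : 2 * δ'j ≤ 1 / 2)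
    (h15₂ : ∀ n, n < j → ∀ z, tlo L lo₂ n ≤ z → z ≤ thi L hi₂ n → ∀ r : Fin d → Fin L,
      axialFn (avgIter L U₀ (j - (n + 1))) ((L : ℤ) • z) ((L : ℤ) • z + boxVec L r) = 1)
    (h127 : ∀ x ν, lo₂ ≤ x → x + e ν ≤ hi₂ → ‖((V x ν * (avgIter L U₀ j x ν)⁻¹ : 𝔸ˣ) : 𝔸) - 1‖ < 2 * δ'j)
    (hX₂ : ∀ i, rg i = false → dep i ≤ j ∧ tlo L lo₂ (dep i) ≤ pt i ∧ pt i + e (dir i) ≤ thi L hi₂ (dep i))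
    (hfar₂ : ∀ y' i, i ∈ boxT L j S T y' → rg i = true → M * R ≤ (cubeGeometry L j S T).dist y y')
    (hfar₃ : ∀ y' i, i ∈ boxT L j S T y' → rg i = false → dep i ≠ 0 → 6 * (L : ℝ) * M * R ≤ (cubeGeometry L j S T).dist y y')
    {α₀ : ℝ} (hα : 0 < α₀) (hα3 : C0 d * α₀ ≤ 1 / 3) (hα4 : 4 * α₀ ≤ c2' d L)
    (h52 : pdev U₀ < α₀ * (((L : ℝ) ^ j)⁻¹) ^ 2)
    {Hf : B7Prop1Explicit.Site d → Fin d → 𝔸}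
    (hHf : Hf = fun x => ev x (chartH179 𝒢 W D2 H₀
      (fun Y : S → 𝔸 => Y - H (Dfix (B11Eq44Concrete.Cmap L U₁ S T j) (H : (T → 𝔸) →ₗ[ℂ] (S → 𝔸))
        ((8 * (131072 * ((d : ℝ) + 1) ^ 2) * Real.exp (4 * (800 * ((d : ℝ) + 1) ^ 2 * ((d : ℝ) + 4)) * α₁)) *
          ((L : ℝ) ^ j) ^ 2) Y)) ε₄
      (fun i => if rg i then
            mlog (((avgIter L U₀ (j + 1 - dep i) (pt i) (dir i) *
              (pullIter L (avgIter L U₀ (j + 1)) (dep i) (pt i) (dir i))⁻¹ : 𝔸ˣ) : 𝔸))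
          else
            mlog (((pullIter L V (dep i) (pt i) (dir i) *
              (avgIter L U₀ (j - dep i) (pt i) (dir i))⁻¹ : 𝔸ˣ) : 𝔸)))))
    (q : B7Prop1Explicit.Site d) (κ : Fin d)
    (hCB : const190 1 1 b3.κ BG θW cΔ A₀ AH
        (d * Real.exp (1 / 2 * d * δ₀) *
          ((1 - (C3Gen d L * (((L : ℝ) ^ j) ^ 2 * (2 * ε₃)) * (2 * d) * B₁ * Real.exp (2 * d * δ₀)) *
              (d * B6.c0 δ₀ (1 / 2) ^ d))⁻¹ * (Real.exp (d * δ₀) * (C3Gen d L * ((L : ℝ) ^ j) ^ 2 * (2 * ε₃)))))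
        (B6.c0 δ₀ (1 / 8) ^ d) * B6.c0 δ₀ α ^ d < B₃) (hB₃ : 0 ≤ B₃)
    (hbox : ∀ y', B7Prop1Local.InBox (B7Prop1Local.loK L j q) (B7Prop1Local.bondHiK L j q κ) y' → y' ∈ box y)
    (hL1 : 1 ≤ L)
    (hA₁0 : 0 ≤ A₁) (hp₀1 : 1 ≤ p₀) (hγ1 : γ ≤ 1)
    (hsmγ : 2048 * (d : ℝ) * (A₁ * (4 * (p₀ : ℝ)) ^ p₀ * Real.sqrt γ / (2 * (136 * ((d : ℝ) + 1) + 320 * d))) ≤ 1)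
    (hc₃γ : 2 * (A₁ * (4 * (p₀ : ℝ)) ^ p₀ * Real.sqrt γ / (2 * (136 * ((d : ℝ) + 1) + 320 * d))) ≤ c3 d L)
    (hsmallγ : Real.exp (4 * (800 * ((d : ℝ) + 1) ^ 2 * ((d : ℝ) + 4)) * α₀)
      * (1 + 8 * (131072 * ((d : ℝ) + 1) ^ 2)
        * (A₁ * (4 * (p₀ : ℝ)) ^ p₀ * Real.sqrt γ / (2 * (136 * ((d : ℝ) + 1) + 320 * d)))) ≤ 2)
    (hflow : εj1 ≤ (1 + 2 * β₀) * εj) (hA₁ : A₁ ≠ 0) (hp₀v : logPow p₀ gj ≠ 0)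
    (hδ' : δ'j = gj * A₁ * logPow p₁ gj) (hεj : εj = gj * A₀' * logPow p₀ gj) (hδj : δj = gj * A₁ * logPow p₀ gj)
    (hr : 1 ≤ r) (hp : p₁ < p₀) (hgj : 0 < gj) (hgjγ : gj ≤ γ) (hR : B14.IsRj L r gj1 R) (hgj1 : 0 < gj1)
    (hgj1γ : gj1 ≤ γ) (hγe : 1 ≤ Real.log (γ ^ 2)⁻¹) (hτM : 1 ≤ τ * M)
    (hK' : 0 ≤ 44 * (d : ℝ) ^ 2 * (1 + β₀) * (A₀' / A₁)) (hδj0 : 0 ≤ δj) (hδ'j : 0 < δ'j)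
    (hγ : (136 * ((d : ℝ) + 1) + 320 * d) * B₃
      * (4 * (Real.log (γ ^ 2)⁻¹)⁻¹ + 44 * (d : ℝ) ^ 2 * (1 + β₀) * (A₀' / A₁) * γ ^ 2) ≤ 1 / 2) :
    ‖((avgIter L
          (gaugeAct (B7Eq84Concrete.glev L hL1 U₀
              (expCfg (fun y μ => ((Complex.I : ℂ) * ((((L : ℝ) ^ j)⁻¹ : ℝ) : ℂ)) • Hf y μ)) j 0)⁻¹
            (expCfg (fun y μ => ((Complex.I : ℂ) * ((((L : ℝ) ^ j)⁻¹ : ℝ) : ℂ)) • Hf y μ) * U₀)) j q κ : 𝔸ˣ) : 𝔸)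
        * (((avgIter L U₀ j q κ)⁻¹ : 𝔸ˣ) : 𝔸) - 1‖ ≤ δj / 2 := by
  obtain ⟨h190, hmv⟩ := ineq190_and_hmv_supSize_concreteC_kernel L hL hAG k₁ U₁ hU₁ hα₁ hα₁3 hα₁4 h52₁ hb₁ hsmall₁ hc₃₁
    h145₁ h155₁ S T hj hd1 Reg hWa H hB₀' hH46 hc1h hε₃ h18 h2 hnest hδ₀ hB₁ hHker hq hB ev hev hBG hθW hcΔ hA₀ hAH hG190
    hD2H0 hH0 hH h189 hqG
    (fun B' => fun x => ev x (chartH179 𝒢 W D2 H₀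
      (fun Y : S → 𝔸 => Y - H (Dfix (B11Eq44Concrete.Cmap L U₁ S T j) (H : (T → 𝔸) →ₗ[ℂ] (S → 𝔸))
        ((8 * (131072 * ((d : ℝ) + 1) ^ 2) * Real.exp (4 * (800 * ((d : ℝ) + 1) ^ 2 * ((d : ℝ) + 4)) * α₁)) *
          ((L : ℝ) ^ j) ^ 2) Y)) ε₄ B'))
    (fun t => (LinearMap.pi fun x => ((ev x : (S → 𝔸) →L[ℝ] (Fin d → 𝔸)) : (S → 𝔸) →ₗ[ℝ] (Fin d → 𝔸))) ∘ₗ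
      ((fderiv ℂ (chartH179 𝒢 W D2 H₀
        (fun Y : S → 𝔸 => Y - H (Dfix (B11Eq44Concrete.Cmap L U₁ S T j) (H : (T → 𝔸) →ₗ[ℂ] (S → 𝔸))
          ((8 * (131072 * ((d : ℝ) + 1) ^ 2) * Real.exp (4 * (800 * ((d : ℝ) + 1) ^ 2 * ((d : ℝ) + 4)) * α₁)) *
            ((L : ℝ) ^ j) ^ 2) Y)) ε₄)
        ((t : ℝ) • (fun i => if rg i then
            mlog (((avgIter L U₀ (j + 1 - dep i) (pt i) (dir i) *
              (pullIter L (avgIter L U₀ (j + 1)) (dep i) (pt i) (dir i))⁻¹ : 𝔸ˣ) : 𝔸))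
          else
            mlog (((pullIter L V (dep i) (pt i) (dir i) *
              (avgIter L U₀ (j - dep i) (pt i) (dir i))⁻¹ : 𝔸ˣ) : 𝔸))))).restrictScalars ℝ :
            (T → 𝔸) →ₗ[ℝ] (S → 𝔸)))
    (fun _ => rfl) (fun _ => rfl) y
  have hK : 0 ≤ const190 1 1 b3.κ BG θW cΔ A₀ AH
      (d * Real.exp (1 / 2 * d * δ₀) *
        ((1 - (C3Gen d L * (((L : ℝ) ^ j) ^ 2 * (2 * ε₃)) * (2 * d) * B₁ * Real.exp (2 * d * δ₀)) *
            (d * B6.c0 δ₀ (1 / 2) ^ d))⁻¹ * (Real.exp (d * δ₀) * (C3Gen d L * ((L : ℝ) ^ j) ^ 2 * (2 * ε₃)))))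
      (B6.c0 δ₀ (1 / 8) ^ d) :=
    const190_nonneg' zero_le_one zero_le_one b3.κ_nonneg (c0_pow_nonneg δ₀ (1 / 8) d) hBG hθW hcΔ hA₀ hAH
      (thetaD_nonneg hε₃.le hq) hqG
  have hrow : RowSum (cubeGeometry L j S T) (α * δ₀) (B6.c0 δ₀ α ^ d) := rowSum_cubeGeometry L j S T (mul_pos hσ hδ₀)
  subst hHf
  exact ineq139_half_of_ineq190_layer (boxT L j S T) (blkT L j S T) rg dep pt dir box blk h190 hK (dist_nonneg_cubeGeometry L j S T)
    hrow hτ hστ y hL hd1 hAG hU₀ hβ hε1' hε3' hε2' hεs' lo₁ hi₁ hlohi₁ h124₁ h15₁ hX₁ hε hε3 hε2 lo₂ hi₂ hlohi₂ h124₂ V hV hδ0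
    hδε hs hδ2 h15₂ h127 hX₂ hfar₂ hfar₃ hα hα3 hα4 h52 _ q κ hmv hCB hB₃ hbox hL1 hA₁0 hp₀1 hγ1 hsmγ hc₃γ hsmallγ hflow hA₁
    hp₀v hδ' hεj hδj hr hp hgj hgjγ hR hgj1 hgj1γ hγe hτM hK' hδj0 hδ'j hγ

end Eq139

/-! ## §3 (1.56)–(1.58) ⇒ the second expression of (1.54) at the concrete `C_k`: the (1.56) tower field on the coarse bonds `T`, weighted sup
output size through the weighted presentation `(L^{k−j−1})⁻¹ • ev` -/

section Eq154

variable {𝔸 : Type} [NormedRing 𝔸] [NormedAlgebra ℂ 𝔸] [CompleteSpace 𝔸] [NormOneClass 𝔸]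

variable (L : ℕ) (hL : 2 ≤ L) {G : Subgroup 𝔸ˣ} (hAG : AvgClosed d L G) (k₁ : ℕ)
  (U₁ : B7Prop1Explicit.Site d → Fin d → 𝔸ˣ) (hU₁ : ∀ x κ, U₁ x κ ∈ G) {α₁ : ℝ} (hα₁ : 0 < α₁)
  (hα₁3 : C0 d * α₁ ≤ 1 / 3) (hα₁4 : 4 * α₁ ≤ c2' d L) (h52₁ : pdev U₁ < α₁ * (((L : ℝ) ^ k₁)⁻¹) ^ 2)
  {b₁ : ℝ} (hb₁ : 0 < b₁)
  (hsmall₁ : Real.exp (4 * (800 * ((d : ℝ) + 1) ^ 2 * ((d : ℝ) + 4)) * α₁)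
    * (1 + 8 * (131072 * ((d : ℝ) + 1) ^ 2) * ((L : ℝ) ^ k₁ * b₁)) ≤ 2)
  (hc₃₁ : 4 * ((L : ℝ) ^ k₁ * b₁) < c3 d L)
  (h145₁ : 8 * d * thetaGen d L α₁ * (L : ℝ)⁻¹ ^ 4 ≤ 1)
  (h155₁ : (2 * (L : ℝ) - 1) * (L : ℝ)⁻¹ ^ 2 + 2 * d * thetaGen d L α₁ * (L : ℝ)⁻¹ ^ 3
    + 1 / 8 * (1 + 2 * d * thetaGen d L α₁ * (L : ℝ)⁻¹ ^ 2 + 2 * d * C3Gen d L * ((L : ℝ) ^ k₁ * b₁)) * (L : ℝ)⁻¹ ^ 2 ≤ 1)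
  (S T : Finset (B7Prop1Explicit.Site d × Fin d))

variable {𝒵 : Type} [NormedAddCommGroup 𝒵] [NormedSpace ℂ 𝒵] [CompleteSpace 𝒵]
  {𝒢 : 𝒵 →L[ℂ] (S → 𝔸)} {W : (S → 𝔸) → 𝒵} {D2 : (S → 𝔸) →L[ℂ] 𝒵} {H₀ : (T → 𝔸) →L[ℂ] (S → 𝔸)} {B₀ θ C₄ a₃ 𝔧 𝔞 ε₄ : ℝ}

include hL hAG hU₁ hα₁ hα₁3 hα₁4 h52₁ hb₁ hsmall₁ hc₃₁ h145₁ h155₁ in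
/-- **(1.57)–(1.58) ⇒ «the second expression on the right-hand side [of (1.54)] is much smaller than δ′_j» ON THE LATTICE MODEL, AT THE CONCRETE
`C_k(U₁, ·)` OF [4] ON THE SINGLE-SCALE CUBE GEOMETRY** — r12's `B15From190LayerSizes.second154_lt_of_ineq190_layer` (argument field `B :=` p29's
(1.56) tower field of the fine field `U = U_k^{(n+1)}`, `k` levels, HERE INDEXED BY THE COARSE BONDS `T` of the scheme; B-size `44d²B₃ε_k` and
localisation discharged there; input size = the sup size of the coarse bonds of the cube geometry at scale `k`; output size WITH PRINT'S WEIGHT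
(1.57) `(L^{j+1}η) = (L^{k−j−1})⁻¹`: `supSize … box blk` at the rescaled function `(L^{k−j−1})⁻¹ • ℍ`) for the presented chart `ℍ = x ↦ ev x
(𝓗(B))`, `𝓗 = chartH179 𝒢 W D2 H₀ (· − H(Dfix(C_k(U₁,·)) ·)) ε₄`, with `h190`/`hmv` SUPPLIED BY NAME from r08's
`B11Ineq73HasMajConcrete.ineq190_and_hmv_supSize_concreteC_kernel` THROUGH THE WEIGHTED PRESENTATION `x ↦ (L^{k−j−1})⁻¹ • ev x` (compatibility
letter `hevw`: the weighted values are dominated by the sup size of the fine bonds — the entry `(L^jη)^{−1}` of (190)'s bracket); (190), mean value,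
(73), (2.54), (2.61) at `⅛δ₀`, `hN`/`hBloc` DISCHARGED; the knit's row sum at `σ = αδ₀` is `rowSum_cubeGeometry`, `hdist` is
`dist_nonneg_cubeGeometry`.  Remaining: as in §1, and the knit's side conditions verbatim (the ten-layers geometry `δ10MΣR + δMR_k ≤ τD` as `hgeom`
in the cube distance, `h156`, `h15`, `hX`/`hfar`/`hbox`, the [III] (2.4) letters, the flow and γ-clauses); the tower's fine field `U`, the consumer's
background `U₀` and the background `U₁` of `C_k` are NOT identified (print: one configuration — instantiate).
[cite: Balaban1989LargeFieldI, (1.54) p.187, (1.56)–(1.58) p.188; Balaban1985Variational, Prop. 9 (190) pp.308–309, (179)–(180) p.306, (73) p.289, Prop. 3 p.289; Balaban1984PropagatorsII, Lemma 2.1 (2.61) p.234, (2.54) p.233] -/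
theorem second154_lt_layer_concreteC {j k : ℕ} (hk : k ≤ k₁) (hd1 : 1 ≤ d)
    (Reg : Regime 𝒢 0 W B₀ θ C₄ a₃ 𝔧 𝔞 ε₄) (hWa : AnalyticOnNhd ℂ W {Y : S → 𝔸 | ‖Y‖ < a₃})
    (H : (T → 𝔸) →L[ℂ] (S → 𝔸)) {B₀' : ℝ} (hB₀' : 0 ≤ B₀') (hH46 : ∀ X, ‖H X‖ ≤ B₀' * ‖X‖)
    {c1h ε₃ : ℝ} (hc1h : 1 ≤ c1h) (hε₃ : 0 < ε₃)
    (h18 : 18 * ((8 * (131072 * ((d : ℝ) + 1) ^ 2) * Real.exp (4 * (800 * ((d : ℝ) + 1) ^ 2 * ((d : ℝ) + 4)) * α₁)) *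
      ((L : ℝ) ^ k) ^ 2) * B₀' * d * c1h * ε₃ ≤ 1) (h2 : 2 * ε₃ ≤ b₁ / 2) (hnest : ε₄ + 𝔞 ≤ ε₃)
    {δ₀ B₁ : ℝ} (hδ₀ : 0 < δ₀) (hB₁ : 0 ≤ B₁)
    (hHker : ∀ (c'' : T) (Y : 𝔸) (s : S),
      ‖H (Pi.single c'' Y) s‖ ≤ B₁ * Real.exp (-(δ₀ * ((B7Prop1Explicit.l1 (loK L k c''.1.1 - s.1.1) : ℝ) / (L : ℝ) ^ k))) * ‖Y‖)
    (hq : (C3Gen d L * (((L : ℝ) ^ k) ^ 2 * (2 * ε₃)) * (2 * d) * B₁ * Real.exp (2 * d * δ₀)) * (d * B6.c0 δ₀ (1 / 2) ^ d) < 1)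
    -- p29's (1.56) tower of the fine field `U`, `k` levels, on the coarse bonds `T`; its field in the domain of (180)
    (dep : T → ℕ) (pt : T → B7Prop1Explicit.Site d) (dir : T → Fin d)
    (U : B7Prop1Explicit.Site d → Fin d → 𝔸ˣ) (hU : ∀ x κ, U x κ ∈ G)
    (hB : ‖H₀ (fun i => mlog (((avgIter L U (k - dep i) (pt i) (dir i) *
          (pullIter L (avgIter L U k) (dep i) (pt i) (dir i))⁻¹ : 𝔸ˣ) : 𝔸)))‖ < 𝔞 ∧
      ‖D2 (H₀ (fun i => mlog (((avgIter L U (k - dep i) (pt i) (dir i) *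
          (pullIter L (avgIter L U k) (dep i) (pt i) (dir i))⁻¹ : 𝔸ˣ) : 𝔸))))‖ < 𝔧)
    -- the weighted output presentation on the cube geometry
    (box : (cubeGeometry L k S T).Site → Finset (B7Prop1Explicit.Site d))
    (blk : B7Prop1Explicit.Site d → (cubeGeometry L k S T).Site)
    (ev : B7Prop1Explicit.Site d → ((S → 𝔸) →L[ℝ] (Fin d → 𝔸))) {b3 : BlockNorm (cubeGeometry L k S T) 𝒵}
    (hevw : ∀ (y : (cubeGeometry L k S T).Site) (v : S → 𝔸), ∀ x ∈ box y,
      ‖((((L : ℝ) ^ (k - j - 1))⁻¹) • ev x) v‖ ≤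
        (supSize (cubeGeometry L k S T) (boxS L k S T) (blkS L k S T) : BlockNorm (cubeGeometry L k S T) (S → 𝔸)).loc y v)
    -- the located leaves of [15] Sect. G for the abstract data on the cube sizes
    {BG θW cΔ A₀ AH : ℝ} (hBG : 0 ≤ BG) (hθW : 0 ≤ θW) (hcΔ : 0 ≤ cΔ) (hA₀ : 0 ≤ A₀) (hAH : 0 ≤ AH)
    (hG190 : HasMaj b3 (supSize (cubeGeometry L k S T) (boxS L k S T) (blkS L k S T) : BlockNorm (cubeGeometry L k S T) (S → 𝔸))
      (𝒢.restrictScalars ℝ : 𝒵 →ₗ[ℝ] (S → 𝔸)) (fun y y' => BG * Real.exp (-(δ₀ * (cubeGeometry L k S T).dist y y'))))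
    (hD2H0 : HasMaj (supSize (cubeGeometry L k S T) (boxT L k S T) (blkT L k S T) : BlockNorm (cubeGeometry L k S T) (T → 𝔸)) b3
      ((D2 ∘L H₀).restrictScalars ℝ : (T → 𝔸) →ₗ[ℝ] 𝒵) (fun y y' => cΔ * Real.exp (-(δ₀ * (cubeGeometry L k S T).dist y y'))))
    (hH0 : HasMaj (supSize (cubeGeometry L k S T) (boxT L k S T) (blkT L k S T) : BlockNorm (cubeGeometry L k S T) (T → 𝔸))
      (supSize (cubeGeometry L k S T) (boxS L k S T) (blkS L k S T) : BlockNorm (cubeGeometry L k S T) (S → 𝔸))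
      (H₀.restrictScalars ℝ : (T → 𝔸) →ₗ[ℝ] (S → 𝔸)) (fun y y' => A₀ * Real.exp (-(δ₀ * (cubeGeometry L k S T).dist y y'))))
    (hH : HasMaj (supSize (cubeGeometry L k S T) (boxT L k S T) (blkT L k S T) : BlockNorm (cubeGeometry L k S T) (T → 𝔸))
      (supSize (cubeGeometry L k S T) (boxS L k S T) (blkS L k S T) : BlockNorm (cubeGeometry L k S T) (S → 𝔸))
      (H.restrictScalars ℝ : (T → 𝔸) →ₗ[ℝ] (S → 𝔸)) (fun y y' => AH * Real.exp (-(δ₀ / 2 * (cubeGeometry L k S T).dist y y'))))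
    (h189 : ∀ B' : T → 𝔸, ‖H₀ B'‖ < 𝔞 → ‖D2 (H₀ B')‖ < 𝔧 →
      Ineq189 (supSize (cubeGeometry L k S T) (boxS L k S T) (blkS L k S T) : BlockNorm (cubeGeometry L k S T) (S → 𝔸)) b3
        ((fderiv ℂ W (solA180 𝒢 W D2 H₀ ε₄ B' + H₀ B')).restrictScalars ℝ : (S → 𝔸) →ₗ[ℝ] 𝒵) θW δ₀)
    (hqG : qG b3.κ 1 BG θW (B6.c0 δ₀ (1 / 8) ^ d) < 1)
    -- the [IV] side: the letters of `B15From190LayerSizes.second154_lt_of_ineq190_layer` minus `h190`, `hmv`, `hdist`, `hrow`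
    {α τ Dd B₃ δ M εk εj β₀ γ gj A₀' A₁ : ℝ} {R : ℕ → ℝ} {Rn r p₀ p₁ : ℕ}
    (hσ : 0 < α) (hτ : 0 ≤ τ) (hστ : α * δ₀ + τ ≤ δ₀ / 8) (y : (cubeGeometry L k S T).Site)
    (hB₃ : 0 < B₃) (hεk : 0 < εk)
    (hs3 : C0 d * (2 * B₃ * εk) ≤ 1 / 3) (hs2 : 2 * (2 * B₃ * εk) ≤ c2' d L)
    (hs : 11 * (d : ℝ) ^ 2 * (2 * B₃ * εk) ≤ 1 / 6) (lo hi : B7Prop1Explicit.Site d) (hlohi : lo ≤ hi)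
    (h156 : pdevOn (tlo L lo k) (thi L hi k) U < 2 * B₃ * εk * (((L : ℝ) ^ k)⁻¹) ^ 2)
    (h15 : ∀ n, n < k → ∀ z, tlo L lo n ≤ z → z ≤ thi L hi n → ∀ r : Fin d → Fin L,
      axialFn (avgIter L U (k - (n + 1))) ((L : ℤ) • z) ((L : ℤ) • z + boxVec L r) = 1)
    (hX : ∀ i, dep i ≤ k ∧ tlo L lo (dep i) ≤ pt i ∧ pt i + e (dir i) ≤ thi L hi (dep i))
    (hfar : ∀ y' i, i ∈ boxT L k S T y' → Dd ≤ (cubeGeometry L k S T).dist y y')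
    {U₀ : B7Prop1Explicit.Site d → Fin d → 𝔸ˣ} (hU₀ : ∀ x κ, U₀ x κ ∈ G) {α₀ : ℝ} (hα : 0 < α₀)
    (hα3 : C0 d * α₀ ≤ 1 / 3) (hα4 : 4 * α₀ ≤ c2' d L) (h52 : pdev U₀ < α₀ * (((L : ℝ) ^ j)⁻¹) ^ 2)
    {Hf : B7Prop1Explicit.Site d → Fin d → 𝔸}
    (hHf : Hf = fun x => ev x (chartH179 𝒢 W D2 H₀
      (fun Y : S → 𝔸 => Y - H (Dfix (B11Eq44Concrete.Cmap L U₁ S T k) (H : (T → 𝔸) →ₗ[ℂ] (S → 𝔸))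
        ((8 * (131072 * ((d : ℝ) + 1) ^ 2) * Real.exp (4 * (800 * ((d : ℝ) + 1) ^ 2 * ((d : ℝ) + 4)) * α₁)) *
          ((L : ℝ) ^ k) ^ 2) Y)) ε₄
      (fun i => mlog (((avgIter L U (k - dep i) (pt i) (dir i) *
          (pullIter L (avgIter L U k) (dep i) (pt i) (dir i))⁻¹ : 𝔸ˣ) : 𝔸)))))
    (q : B7Prop1Explicit.Site d) (κ : Fin d)
    (hgeom : δ * 10 * M * (∑ l ∈ Finset.Ico (j + 1) k, R l) + δ * M * R k ≤ τ * Dd)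
    (hCB : const190 1 1 b3.κ BG θW cΔ A₀ AH
        (d * Real.exp (1 / 2 * d * δ₀) *
          ((1 - (C3Gen d L * (((L : ℝ) ^ k) ^ 2 * (2 * ε₃)) * (2 * d) * B₁ * Real.exp (2 * d * δ₀)) *
              (d * B6.c0 δ₀ (1 / 2) ^ d))⁻¹ * (Real.exp (d * δ₀) * (C3Gen d L * ((L : ℝ) ^ k) ^ 2 * (2 * ε₃)))))
        (B6.c0 δ₀ (1 / 8) ^ d) * B6.c0 δ₀ α ^ d ≤ B₃)
    (hjk : j < k) (hδM : (L : ℝ) + 1 ≤ δ * M) (hR1 : ∀ l, 1 ≤ R l)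
    (hstep : ∀ l, j ≤ l → l < k → R l ≤ (L : ℝ) * R (l + 1)) (hεkflow : εk ≤ (1 + β₀) * Real.sqrt ((k : ℝ) - j) * εj)
    (hεj : 0 < εj) (hβ₀ : 0 ≤ β₀)
    (hbox : ∀ y', B7Prop1Local.InBox (B7Prop1Local.loK L j q) (B7Prop1Local.bondHiK L j q κ) y' → y' ∈ box y) (hL1 : 1 ≤ L)
    (hRj : R j = (Rn : ℝ)) (hr : 1 ≤ r) (hp : p₁ ≤ p₀) (hRn : B14.IsRj L r gj Rn) (hgj : 0 < gj) (hgjγ : gj ≤ γ)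
    (hγe : 1 ≤ Real.log (γ ^ 2)⁻¹) (hA₀' : 0 ≤ A₀') (hεjdef : εj = gj * p0Profile A₀' p₀ gj)
    (hγ : (136 * ((d : ℝ) + 1) + 320 * d) * (44 * (d : ℝ) ^ 2 * B₃ ^ 2 * (1 + β₀)) * A₀'
      * (2 * ((p₀ - p₁ : ℕ) : ℝ)) ^ (p₀ - p₁) * γ < A₁)
    (hεj1 : εj ≤ 1)
    (hsmγ : 2048 * (d : ℝ) * (44 * (d : ℝ) ^ 2 * B₃ ^ 2 * (1 + β₀) * γ ^ 2) ≤ 1)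
    (hc₃γ : 2 * (44 * (d : ℝ) ^ 2 * B₃ ^ 2 * (1 + β₀) * γ ^ 2) ≤ c3 d L)
    (hsmallγ : Real.exp (4 * (800 * ((d : ℝ) + 1) ^ 2 * ((d : ℝ) + 4)) * α₀)
      * (1 + 8 * (131072 * ((d : ℝ) + 1) ^ 2) * (44 * (d : ℝ) ^ 2 * B₃ ^ 2 * (1 + β₀) * γ ^ 2)) ≤ 2) :
    ‖((avgIter L
          (gaugeAct (B7Eq84Concrete.glev L hL1 U₀
              (expCfg (fun y μ => ((Complex.I : ℂ) * ((((L : ℝ) ^ j)⁻¹ : ℝ) : ℂ)) • Hf y μ)) j 0)⁻¹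
            (expCfg (fun y μ => ((Complex.I : ℂ) * ((((L : ℝ) ^ j)⁻¹ : ℝ) : ℂ)) • Hf y μ) * U₀)) j q κ : 𝔸ˣ) : 𝔸)
        * (((avgIter L U₀ j q κ)⁻¹ : 𝔸ˣ) : 𝔸) - 1‖ < gj * p0Profile A₁ p₁ gj := by
  obtain ⟨h190, hmv⟩ := ineq190_and_hmv_supSize_concreteC_kernel L hL hAG k₁ U₁ hU₁ hα₁ hα₁3 hα₁4 h52₁ hb₁ hsmall₁ hc₃₁
    h145₁ h155₁ S T hk hd1 Reg hWa H hB₀' hH46 hc1h hε₃ h18 h2 hnest hδ₀ hB₁ hHker hq hB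
    (fun x => (((L : ℝ) ^ (k - j - 1))⁻¹) • ev x) hevw hBG hθW hcΔ hA₀ hAH hG190 hD2H0 hH0 hH h189 hqG
    (fun B' => (((L : ℝ) ^ (k - j - 1))⁻¹) • fun x => ev x (chartH179 𝒢 W D2 H₀
      (fun Y : S → 𝔸 => Y - H (Dfix (B11Eq44Concrete.Cmap L U₁ S T k) (H : (T → 𝔸) →ₗ[ℂ] (S → 𝔸))
        ((8 * (131072 * ((d : ℝ) + 1) ^ 2) * Real.exp (4 * (800 * ((d : ℝ) + 1) ^ 2 * ((d : ℝ) + 4)) * α₁)) *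
          ((L : ℝ) ^ k) ^ 2) Y)) ε₄ B'))
    (fun t => (LinearMap.pi fun x => (((((L : ℝ) ^ (k - j - 1))⁻¹) • ev x : (S → 𝔸) →L[ℝ] (Fin d → 𝔸)) :
        (S → 𝔸) →ₗ[ℝ] (Fin d → 𝔸))) ∘ₗ
      ((fderiv ℂ (chartH179 𝒢 W D2 H₀
        (fun Y : S → 𝔸 => Y - H (Dfix (B11Eq44Concrete.Cmap L U₁ S T k) (H : (T → 𝔸) →ₗ[ℂ] (S → 𝔸))
          ((8 * (131072 * ((d : ℝ) + 1) ^ 2) * Real.exp (4 * (800 * ((d : ℝ) + 1) ^ 2 * ((d : ℝ) + 4)) * α₁)) *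
            ((L : ℝ) ^ k) ^ 2) Y)) ε₄)
        ((t : ℝ) • (fun i => mlog (((avgIter L U (k - dep i) (pt i) (dir i) *
          (pullIter L (avgIter L U k) (dep i) (pt i) (dir i))⁻¹ : 𝔸ˣ) : 𝔸))))).restrictScalars ℝ :
            (T → 𝔸) →ₗ[ℝ] (S → 𝔸)))
    (fun _ => rfl) (fun _ => rfl) y
  have hK : 0 ≤ const190 1 1 b3.κ BG θW cΔ A₀ AH
      (d * Real.exp (1 / 2 * d * δ₀) *
        ((1 - (C3Gen d L * (((L : ℝ) ^ k) ^ 2 * (2 * ε₃)) * (2 * d) * B₁ * Real.exp (2 * d * δ₀)) *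
            (d * B6.c0 δ₀ (1 / 2) ^ d))⁻¹ * (Real.exp (d * δ₀) * (C3Gen d L * ((L : ℝ) ^ k) ^ 2 * (2 * ε₃)))))
      (B6.c0 δ₀ (1 / 8) ^ d) :=
    const190_nonneg' zero_le_one zero_le_one b3.κ_nonneg (c0_pow_nonneg δ₀ (1 / 8) d) hBG hθW hcΔ hA₀ hAH
      (thetaD_nonneg hε₃.le hq) hqG
  have hrow : RowSum (cubeGeometry L k S T) (α * δ₀) (B6.c0 δ₀ α ^ d) := rowSum_cubeGeometry L k S T (mul_pos hσ hδ₀)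
  subst hHf
  exact second154_lt_of_ineq190_layer (boxT L k S T) (blkT L k S T) dep pt dir box blk h190 hK (dist_nonneg_cubeGeometry L k S T)
    hrow hτ hστ y hL hd1 hAG U hU hB₃ hεk hs3 hs2 hs lo hi hlohi h156 h15 hX hfar hU₀ hα hα3 hα4 h52 _ q κ hmv hgeom hCB hjk hδM
    hR1 hstep hεkflow hεj hβ₀ hbox hL1 hRj hr hp hRn hgj hgjγ hγe hA₀' hεjdef hγ hεj1 hsmγ hc₃γ hsmallγ

end Eq154

/-! ## §4 (v1.1) (1.31) at the concrete `C_j`: sup AND covariant-derivative output sizes (the covariant pair from `B11Ineq190DerivConcreteC`) -/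

section Eq131C

variable {𝔸 : Type} [CStarAlgebra 𝔸] [Nontrivial 𝔸]

variable (L : ℕ) (hL : 2 ≤ L) {G : Subgroup 𝔸ˣ} (hAG : AvgClosed d L G) (k₁ : ℕ)
  (U₁ : B7Prop1Explicit.Site d → Fin d → 𝔸ˣ) (hU₁ : ∀ x κ, U₁ x κ ∈ G) {α₁ : ℝ} (hα₁ : 0 < α₁)
  (hα₁3 : C0 d * α₁ ≤ 1 / 3) (hα₁4 : 4 * α₁ ≤ c2' d L) (h52₁ : pdev U₁ < α₁ * (((L : ℝ) ^ k₁)⁻¹) ^ 2)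
  {b₁ : ℝ} (hb₁ : 0 < b₁)
  (hsmall₁ : Real.exp (4 * (800 * ((d : ℝ) + 1) ^ 2 * ((d : ℝ) + 4)) * α₁)
    * (1 + 8 * (131072 * ((d : ℝ) + 1) ^ 2) * ((L : ℝ) ^ k₁ * b₁)) ≤ 2)
  (hc₃₁ : 4 * ((L : ℝ) ^ k₁ * b₁) < c3 d L)
  (h145₁ : 8 * d * thetaGen d L α₁ * (L : ℝ)⁻¹ ^ 4 ≤ 1)
  (h155₁ : (2 * (L : ℝ) - 1) * (L : ℝ)⁻¹ ^ 2 + 2 * d * thetaGen d L α₁ * (L : ℝ)⁻¹ ^ 3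
    + 1 / 8 * (1 + 2 * d * thetaGen d L α₁ * (L : ℝ)⁻¹ ^ 2 + 2 * d * C3Gen d L * ((L : ℝ) ^ k₁ * b₁)) * (L : ℝ)⁻¹ ^ 2 ≤ 1)
  (S T : Finset (B7Prop1Explicit.Site d × Fin d))

variable {𝒵 : Type} [NormedAddCommGroup 𝒵] [NormedSpace ℂ 𝒵] [CompleteSpace 𝒵]
  {𝒢 : 𝒵 →L[ℂ] (S → 𝔸)} {W : (S → 𝔸) → 𝒵} {D2 : (S → 𝔸) →L[ℂ] 𝒵} {H₀ : (T → 𝔸) →L[ℂ] (S → 𝔸)} {B₀ θ C₄ a₃ 𝔧 𝔞 ε₄ : ℝ}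

include hL hAG hU₁ hα₁ hα₁3 hα₁4 h52₁ hb₁ hsmall₁ hc₃₁ h145₁ h155₁ in
/-- **(1.31) ⇒ "the functions (1.3) … are equal to 1" ON THE LATTICE MODEL, AT THE CONCRETE `C_j(U₁, ·)` OF [4] ON THE SINGLE-SCALE CUBE
GEOMETRY** — r12's `B15From190LayerSizes.ineq131_lt_of_ineq190_layer` (p29's (1.30) tower field indexed by the coarse bonds `T`; output sizes
`supSize … box blk` — *"on the cube □^∼ this function"* — and `covDerivBlockSize … y₀ Sc ξ U₀` — *"and its covariant derivatives"*) with BOTH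
pairs SUPPLIED BY NAME: `h190₀`/`hmv₀` from r08's `B11Ineq73HasMajConcrete.ineq190_and_hmv_supSize_concreteC_kernel`, `h190₁`/`hmv₁` from
r12's covariant twin `B11Ineq190DerivConcreteC.ineq190_and_hmv_covDerivBlockSize_concreteC_kernel` (v1.1's new import); (190), mean value, (73),
(2.54), (2.61) at `⅛δ₀`, `hN`/`hBloc`, `hTm`/`hTm0` DISCHARGED; the knit's own (2.61) at `σ = αδ₀` is `rowSum_cubeGeometry`.  Remaining: as in
§1 + the first-order compatibility letter `hev₁` and the knit's side conditions verbatim ((1.24) `h124`, `h15`, `hX`/`hfar`, `δ2M₂R_j ≤ τD`,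
the γ-clause `22d²B₃γ² < β/10`, plaquette data). [cite: Balaban1989LargeFieldI, (1.30)–(1.31) pp.183–184, (1.24) p.181; Balaban1985Variational, Prop. 9 (190) pp.308–309, (179)–(180) p.306, (73) p.289, (115) p.294] -/
theorem ineq131_lt_layer_concreteC {j : ℕ} (hj : j ≤ k₁) (hd1 : 1 ≤ d)
    (Reg : Regime 𝒢 0 W B₀ θ C₄ a₃ 𝔧 𝔞 ε₄) (hWa : AnalyticOnNhd ℂ W {Y : S → 𝔸 | ‖Y‖ < a₃})
    (H : (T → 𝔸) →L[ℂ] (S → 𝔸)) {B₀' : ℝ} (hB₀' : 0 ≤ B₀') (hH46 : ∀ X, ‖H X‖ ≤ B₀' * ‖X‖)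
    {c1h ε₃ : ℝ} (hc1h : 1 ≤ c1h) (hε₃ : 0 < ε₃)
    (h18 : 18 * ((8 * (131072 * ((d : ℝ) + 1) ^ 2) * Real.exp (4 * (800 * ((d : ℝ) + 1) ^ 2 * ((d : ℝ) + 4)) * α₁)) *
      ((L : ℝ) ^ j) ^ 2) * B₀' * d * c1h * ε₃ ≤ 1) (h2 : 2 * ε₃ ≤ b₁ / 2) (hnest : ε₄ + 𝔞 ≤ ε₃)
    {δ₀ B₁ : ℝ} (hδ₀ : 0 < δ₀) (hB₁ : 0 ≤ B₁)
    (hHker : ∀ (c'' : T) (Y : 𝔸) (s : S),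
      ‖H (Pi.single c'' Y) s‖ ≤ B₁ * Real.exp (-(δ₀ * ((B7Prop1Explicit.l1 (loK L j c''.1.1 - s.1.1) : ℝ) / (L : ℝ) ^ j))) * ‖Y‖)
    (hq : (C3Gen d L * (((L : ℝ) ^ j) ^ 2 * (2 * ε₃)) * (2 * d) * B₁ * Real.exp (2 * d * δ₀)) * (d * B6.c0 δ₀ (1 / 2) ^ d) < 1)
    -- p29's (1.30) tower (fine field `U₀`) on the coarse bonds `T`; its field in the domain of (180)
    (dep : T → ℕ) (pt : T → B7Prop1Explicit.Site d) (dir : T → Fin d)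
    {U₀ : B7Prop1Explicit.Site d → Fin d → 𝔸ˣ} (hU₀ : ∀ x κ, U₀ x κ ∈ G)
    (hB : ‖H₀ (fun i => mlog (((avgIter L U₀ (j - dep i) (pt i) (dir i) *
          (pullIter L (avgIter L U₀ j) (dep i) (pt i) (dir i))⁻¹ : 𝔸ˣ) : 𝔸)))‖ < 𝔞 ∧
      ‖D2 (H₀ (fun i => mlog (((avgIter L U₀ (j - dep i) (pt i) (dir i) *
          (pullIter L (avgIter L U₀ j) (dep i) (pt i) (dir i))⁻¹ : 𝔸ˣ) : 𝔸))))‖ < 𝔧)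
    -- the output presentation on the cube geometry: values and first covariant derivatives
    (box : (cubeGeometry L j S T).Site → Finset (B7Prop1Explicit.Site d))
    (blk : B7Prop1Explicit.Site d → (cubeGeometry L j S T).Site)
    (y₀ : (cubeGeometry L j S T).Site) (Sc : (cubeGeometry L j S T).Site → Finset (B7Prop1Explicit.Site d × Fin d × Fin d)) {ξ : ℝ}
    (ev : B7Prop1Explicit.Site d → ((S → 𝔸) →L[ℝ] (Fin d → 𝔸))) {b3 : BlockNorm (cubeGeometry L j S T) 𝒵}
    (hev : ∀ (y : (cubeGeometry L j S T).Site) (v : S → 𝔸), ∀ x ∈ box y,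
      ‖ev x v‖ ≤ (supSize (cubeGeometry L j S T) (boxS L j S T) (blkS L j S T) : BlockNorm (cubeGeometry L j S T) (S → 𝔸)).loc y v)
    (hev₁ : ∀ (y : (cubeGeometry L j S T).Site) (v : S → 𝔸),
      (covDerivBlockSize (cubeGeometry L j S T) y₀ Sc ξ U₀).loc y (fun x => ev x v) ≤
        (supSize (cubeGeometry L j S T) (boxS L j S T) (blkS L j S T) : BlockNorm (cubeGeometry L j S T) (S → 𝔸)).loc y v)
    -- the located leaves of [15] Sect. G for the abstract data on the cube sizes
    {BG θW cΔ A₀ AH : ℝ} (hBG : 0 ≤ BG) (hθW : 0 ≤ θW) (hcΔ : 0 ≤ cΔ) (hA₀ : 0 ≤ A₀) (hAH : 0 ≤ AH)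
    (hG190 : HasMaj b3 (supSize (cubeGeometry L j S T) (boxS L j S T) (blkS L j S T) : BlockNorm (cubeGeometry L j S T) (S → 𝔸))
      (𝒢.restrictScalars ℝ : 𝒵 →ₗ[ℝ] (S → 𝔸)) (fun y y' => BG * Real.exp (-(δ₀ * (cubeGeometry L j S T).dist y y'))))
    (hD2H0 : HasMaj (supSize (cubeGeometry L j S T) (boxT L j S T) (blkT L j S T) : BlockNorm (cubeGeometry L j S T) (T → 𝔸)) b3
      ((D2 ∘L H₀).restrictScalars ℝ : (T → 𝔸) →ₗ[ℝ] 𝒵) (fun y y' => cΔ * Real.exp (-(δ₀ * (cubeGeometry L j S T).dist y y'))))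
    (hH0 : HasMaj (supSize (cubeGeometry L j S T) (boxT L j S T) (blkT L j S T) : BlockNorm (cubeGeometry L j S T) (T → 𝔸))
      (supSize (cubeGeometry L j S T) (boxS L j S T) (blkS L j S T) : BlockNorm (cubeGeometry L j S T) (S → 𝔸))
      (H₀.restrictScalars ℝ : (T → 𝔸) →ₗ[ℝ] (S → 𝔸)) (fun y y' => A₀ * Real.exp (-(δ₀ * (cubeGeometry L j S T).dist y y'))))
    (hH : HasMaj (supSize (cubeGeometry L j S T) (boxT L j S T) (blkT L j S T) : BlockNorm (cubeGeometry L j S T) (T → 𝔸))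
      (supSize (cubeGeometry L j S T) (boxS L j S T) (blkS L j S T) : BlockNorm (cubeGeometry L j S T) (S → 𝔸))
      (H.restrictScalars ℝ : (T → 𝔸) →ₗ[ℝ] (S → 𝔸)) (fun y y' => AH * Real.exp (-(δ₀ / 2 * (cubeGeometry L j S T).dist y y'))))
    (h189 : ∀ B' : T → 𝔸, ‖H₀ B'‖ < 𝔞 → ‖D2 (H₀ B')‖ < 𝔧 →
      Ineq189 (supSize (cubeGeometry L j S T) (boxS L j S T) (blkS L j S T) : BlockNorm (cubeGeometry L j S T) (S → 𝔸)) b3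
        ((fderiv ℂ W (solA180 𝒢 W D2 H₀ ε₄ B' + H₀ B')).restrictScalars ℝ : (S → 𝔸) →ₗ[ℝ] 𝒵) θW δ₀)
    (hqG : qG b3.κ 1 BG θW (B6.c0 δ₀ (1 / 8) ^ d) < 1)
    -- the [IV] side: the letters of `B15From190LayerSizes.ineq131_lt_of_ineq190_layer` minus `h190₀,₁`, `hmv₀,₁`, `hdist`, `hrow`
    {α τ Dd B₃ δ M₂ εj β γ gj : ℝ} {r R : ℕ}
    (hσ : 0 < α) (hτ : 0 ≤ τ) (hστ : α * δ₀ + τ ≤ δ₀ / 8) (y : (cubeGeometry L j S T).Site)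
    (hε : 0 < εj) (hε3 : C0 d * εj ≤ 1 / 3) (hε2 : 2 * εj ≤ c2' d L) (hεs : 11 * (d : ℝ) ^ 2 * εj ≤ 1 / 6)
    (lo hi : B7Prop1Explicit.Site d) (hlohi : lo ≤ hi)
    (h124 : pdevOn (tlo L lo j) (thi L hi j) U₀ < (1 - β * (1 / 2)) * εj * (((L : ℝ) ^ j)⁻¹) ^ 2)
    (h15 : ∀ n, n < j → ∀ z, tlo L lo n ≤ z → z ≤ thi L hi n → ∀ r : Fin d → Fin L,
      axialFn (avgIter L U₀ (j - (n + 1))) ((L : ℤ) • z) ((L : ℤ) • z + boxVec L r) = 1)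
    (hX : ∀ i, dep i ≤ j ∧ tlo L lo (dep i) ≤ pt i ∧ pt i + e (dir i) ≤ thi L hi (dep i))
    (hfar : ∀ y' i, i ∈ boxT L j S T y' → Dd ≤ (cubeGeometry L j S T).dist y y')
    (hξ : 0 < ξ) {Hf : B7Prop1Explicit.Site d → Fin d → 𝔸}
    (hHf : Hf = fun x => ev x (chartH179 𝒢 W D2 H₀
      (fun Y : S → 𝔸 => Y - H (Dfix (B11Eq44Concrete.Cmap L U₁ S T j) (H : (T → 𝔸) →ₗ[ℂ] (S → 𝔸))
        ((8 * (131072 * ((d : ℝ) + 1) ^ 2) * Real.exp (4 * (800 * ((d : ℝ) + 1) ^ 2 * ((d : ℝ) + 4)) * α₁)) *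
          ((L : ℝ) ^ j) ^ 2) Y)) ε₄
      (fun i => mlog (((avgIter L U₀ (j - dep i) (pt i) (dir i) *
          (pullIter L (avgIter L U₀ j) (dep i) (pt i) (dir i))⁻¹ : 𝔸ˣ) : 𝔸)))))
    (hsa : ∀ z κ, IsSelfAdjoint (Hf z κ))
    {g : B7Prop1Explicit.Site d → 𝔸ˣ} (hg : ∀ z, g z ∈ U1 𝔸) (μ ν : Fin d) (x : B7Prop1Explicit.Site d)
    (hgeom : δ * 2 * M₂ * R ≤ τ * Dd)
    (hCB : const190 1 1 b3.κ BG θW cΔ A₀ AH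
        (d * Real.exp (1 / 2 * d * δ₀) *
          ((1 - (C3Gen d L * (((L : ℝ) ^ j) ^ 2 * (2 * ε₃)) * (2 * d) * B₁ * Real.exp (2 * d * δ₀)) *
              (d * B6.c0 δ₀ (1 / 2) ^ d))⁻¹ * (Real.exp (d * δ₀) * (C3Gen d L * ((L : ℝ) ^ j) ^ 2 * (2 * ε₃)))))
        (B6.c0 δ₀ (1 / 8) ^ d) * B6.c0 δ₀ α ^ d ≤ B₃) (hB₃ : 0 ≤ B₃)
    (hr : 1 ≤ r) (hR : B14.IsRj L r gj R) (hgj : 0 < gj) (hgγ : gj ≤ γ) (hγe : 1 ≤ Real.log (γ ^ 2)⁻¹)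
    (hc1 : 1 ≤ δ * 2 * M₂) (hγ : B₃ * (22 * (d : ℝ) ^ 2) * γ ^ 2 < β / 10)
    (hx : x ∈ box y) (hxμ : x + e μ ∈ box y) (hxν : x + e ν ∈ box y)
    (hS₁ : (x, μ, ν) ∈ Sc y) (hS₂ : (x, ν, μ) ∈ Sc y)
    (hβ0 : 0 < β) (hβ1 : β ≤ 1) (hε1 : εj ≤ 1) (hεξ : εj * ξ ≤ ((L : ℝ) ^ 2)⁻¹)
    (hdev₀ : ‖B8Ineq132.plaqF U₀ μ ν x - 1‖ < (1 - β / 2) * εj * ξ ^ 2) :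
    ‖B8Ineq132.plaqF (gaugeAct g (B8Lemma1NonAbelian.mulCfg (B8Eq146AExpansion.expCfg
        (B8Eq146AExpansion.iEta ξ Hf)) U₀)) μ ν x - 1‖ < εj * ξ ^ 2 := by
  obtain ⟨h190₀, hmv₀⟩ := ineq190_and_hmv_supSize_concreteC_kernel L hL hAG k₁ U₁ hU₁ hα₁ hα₁3 hα₁4 h52₁ hb₁ hsmall₁ hc₃₁
    h145₁ h155₁ S T hj hd1 Reg hWa H hB₀' hH46 hc1h hε₃ h18 h2 hnest hδ₀ hB₁ hHker hq hB ev hev hBG hθW hcΔ hA₀ hAH hG190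
    hD2H0 hH0 hH h189 hqG
    (fun B' => fun x => ev x (chartH179 𝒢 W D2 H₀
      (fun Y : S → 𝔸 => Y - H (Dfix (B11Eq44Concrete.Cmap L U₁ S T j) (H : (T → 𝔸) →ₗ[ℂ] (S → 𝔸))
        ((8 * (131072 * ((d : ℝ) + 1) ^ 2) * Real.exp (4 * (800 * ((d : ℝ) + 1) ^ 2 * ((d : ℝ) + 4)) * α₁)) *
          ((L : ℝ) ^ j) ^ 2) Y)) ε₄ B'))
    (fun t => (LinearMap.pi fun x => ((ev x : (S → 𝔸) →L[ℝ] (Fin d → 𝔸)) : (S → 𝔸) →ₗ[ℝ] (Fin d → 𝔸))) ∘ₗ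
      ((fderiv ℂ (chartH179 𝒢 W D2 H₀
        (fun Y : S → 𝔸 => Y - H (Dfix (B11Eq44Concrete.Cmap L U₁ S T j) (H : (T → 𝔸) →ₗ[ℂ] (S → 𝔸))
          ((8 * (131072 * ((d : ℝ) + 1) ^ 2) * Real.exp (4 * (800 * ((d : ℝ) + 1) ^ 2 * ((d : ℝ) + 4)) * α₁)) *
            ((L : ℝ) ^ j) ^ 2) Y)) ε₄)
        ((t : ℝ) • (fun i => mlog (((avgIter L U₀ (j - dep i) (pt i) (dir i) *
          (pullIter L (avgIter L U₀ j) (dep i) (pt i) (dir i))⁻¹ : 𝔸ˣ) : 𝔸))))).restrictScalars ℝ :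
            (T → 𝔸) →ₗ[ℝ] (S → 𝔸)))
    (fun _ => rfl) (fun _ => rfl) y
  obtain ⟨h190₁, hmv₁⟩ := B11Ineq190DerivConcreteC.ineq190_and_hmv_covDerivBlockSize_concreteC_kernel L hL hAG k₁ U₁ hU₁ hα₁
    hα₁3 hα₁4 h52₁ hb₁ hsmall₁ hc₃₁ h145₁ h155₁ S T hj hd1 Reg hWa H hB₀' hH46 hc1h hε₃ h18 h2 hnest hδ₀ hB₁ hHker hq hB y₀ Sc
    ev hev₁ hBG hθW hcΔ hA₀ hAH hG190 hD2H0 hH0 hH h189 hqG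
    (fun B' => fun x => ev x (chartH179 𝒢 W D2 H₀
      (fun Y : S → 𝔸 => Y - H (Dfix (B11Eq44Concrete.Cmap L U₁ S T j) (H : (T → 𝔸) →ₗ[ℂ] (S → 𝔸))
        ((8 * (131072 * ((d : ℝ) + 1) ^ 2) * Real.exp (4 * (800 * ((d : ℝ) + 1) ^ 2 * ((d : ℝ) + 4)) * α₁)) *
          ((L : ℝ) ^ j) ^ 2) Y)) ε₄ B'))
    (fun t => (LinearMap.pi fun x => ((ev x : (S → 𝔸) →L[ℝ] (Fin d → 𝔸)) : (S → 𝔸) →ₗ[ℝ] (Fin d → 𝔸))) ∘ₗ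
      ((fderiv ℂ (chartH179 𝒢 W D2 H₀
        (fun Y : S → 𝔸 => Y - H (Dfix (B11Eq44Concrete.Cmap L U₁ S T j) (H : (T → 𝔸) →ₗ[ℂ] (S → 𝔸))
          ((8 * (131072 * ((d : ℝ) + 1) ^ 2) * Real.exp (4 * (800 * ((d : ℝ) + 1) ^ 2 * ((d : ℝ) + 4)) * α₁)) *
            ((L : ℝ) ^ j) ^ 2) Y)) ε₄)
        ((t : ℝ) • (fun i => mlog (((avgIter L U₀ (j - dep i) (pt i) (dir i) *
          (pullIter L (avgIter L U₀ j) (dep i) (pt i) (dir i))⁻¹ : 𝔸ˣ) : 𝔸))))).restrictScalars ℝ :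
            (T → 𝔸) →ₗ[ℝ] (S → 𝔸)))
    (fun _ => rfl) (fun _ => rfl) y
  have hK : 0 ≤ const190 1 1 b3.κ BG θW cΔ A₀ AH
      (d * Real.exp (1 / 2 * d * δ₀) *
        ((1 - (C3Gen d L * (((L : ℝ) ^ j) ^ 2 * (2 * ε₃)) * (2 * d) * B₁ * Real.exp (2 * d * δ₀)) *
            (d * B6.c0 δ₀ (1 / 2) ^ d))⁻¹ * (Real.exp (d * δ₀) * (C3Gen d L * ((L : ℝ) ^ j) ^ 2 * (2 * ε₃)))))
      (B6.c0 δ₀ (1 / 8) ^ d) :=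
    const190_nonneg' zero_le_one zero_le_one b3.κ_nonneg (c0_pow_nonneg δ₀ (1 / 8) d) hBG hθW hcΔ hA₀ hAH
      (thetaD_nonneg hε₃.le hq) hqG
  have hrow : RowSum (cubeGeometry L j S T) (α * δ₀) (B6.c0 δ₀ α ^ d) := rowSum_cubeGeometry L j S T (mul_pos hσ hδ₀)
  subst hHf
  exact ineq131_lt_of_ineq190_layer (boxT L j S T) (blkT L j S T) dep pt dir box blk y₀ Sc h190₀ h190₁ hK
    (dist_nonneg_cubeGeometry L j S T) hrow hτ hστ y hL hd1 hAG hU₀ hε hε3 hε2 hεs lo hi hlohi h124 h15 hX hfar hξ hsa hg μ ν x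
    hmv₀ hmv₁ hgeom hCB hB₃ hr hR hgj hgγ hγe hc1 hγ hx hxμ hxν hS₁ hS₂ hβ0 hβ1 hε1 hεξ hdev₀

end Eq131C

/-! ## §5 (v1.1) (1.90) ⇒ (1.91) at the concrete `C_K`: the (1.90) tower field of a free fine field `Wf`, sup and covariant-derivative sizes -/

section Eq191C

variable {𝔸 : Type} [CStarAlgebra 𝔸] [Nontrivial 𝔸]

variable (L : ℕ) (hL : 2 ≤ L) {G : Subgroup 𝔸ˣ} (hAG : AvgClosed d L G) (k₁ : ℕ)
  (U₁ : B7Prop1Explicit.Site d → Fin d → 𝔸ˣ) (hU₁ : ∀ x κ, U₁ x κ ∈ G) {α₁ : ℝ} (hα₁ : 0 < α₁)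
  (hα₁3 : C0 d * α₁ ≤ 1 / 3) (hα₁4 : 4 * α₁ ≤ c2' d L) (h52₁ : pdev U₁ < α₁ * (((L : ℝ) ^ k₁)⁻¹) ^ 2)
  {b₁ : ℝ} (hb₁ : 0 < b₁)
  (hsmall₁ : Real.exp (4 * (800 * ((d : ℝ) + 1) ^ 2 * ((d : ℝ) + 4)) * α₁)
    * (1 + 8 * (131072 * ((d : ℝ) + 1) ^ 2) * ((L : ℝ) ^ k₁ * b₁)) ≤ 2)
  (hc₃₁ : 4 * ((L : ℝ) ^ k₁ * b₁) < c3 d L)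
  (h145₁ : 8 * d * thetaGen d L α₁ * (L : ℝ)⁻¹ ^ 4 ≤ 1)
  (h155₁ : (2 * (L : ℝ) - 1) * (L : ℝ)⁻¹ ^ 2 + 2 * d * thetaGen d L α₁ * (L : ℝ)⁻¹ ^ 3
    + 1 / 8 * (1 + 2 * d * thetaGen d L α₁ * (L : ℝ)⁻¹ ^ 2 + 2 * d * C3Gen d L * ((L : ℝ) ^ k₁ * b₁)) * (L : ℝ)⁻¹ ^ 2 ≤ 1)
  (S T : Finset (B7Prop1Explicit.Site d × Fin d))

variable {𝒵 : Type} [NormedAddCommGroup 𝒵] [NormedSpace ℂ 𝒵] [CompleteSpace 𝒵]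
  {𝒢 : 𝒵 →L[ℂ] (S → 𝔸)} {W : (S → 𝔸) → 𝒵} {D2 : (S → 𝔸) →L[ℂ] 𝒵} {H₀ : (T → 𝔸) →L[ℂ] (S → 𝔸)} {B₀ θ C₄ a₃ 𝔧 𝔞 ε₄ : ℝ}

include hL hAG hU₁ hα₁ hα₁3 hα₁4 h52₁ hb₁ hsmall₁ hc₃₁ h145₁ h155₁ in
/-- **(1.90) ⇒ (1.91) ON THE LATTICE MODEL, AT THE CONCRETE `C_K(U₁, ·)` OF [4] ON THE SINGLE-SCALE CUBE GEOMETRY, the tower's fine field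
`Wf` FREE (two-sup reading)** — r12's `B15From190LayerSizes.ineq191_twoSup_of_ineq190_layerW` (the (1.90) tower field of a free fine field
`Wf` — print: `U″_{k,Z}` —, `K` levels, indexed by the coarse bonds `T`; B-size `11d²ε_h` (p29's located input `h190p`) and localisation discharged
there; output sizes `supSize … box blk` / `covDerivBlockSize … y₀ Sc ξ U₀` at the consumer's background `U₀` = print's `U_{h,□}(V″)`) for the
presented chart `ℍ = x ↦ ev x (𝓗(B))`, `𝓗 = chartH179 𝒢 W D2 H₀ (· − H(Dfix(C_K(U₁,·)) ·)) ε₄`, BOTH pairs SUPPLIED BY NAME (r08's sup kernel theorem,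
r12's covariant twin); (190), mean value, (73), (2.54), (2.61) at `⅛δ₀`, `hN`/`hBloc`, `hTm`/`hTm0` DISCHARGED.  Remaining: as in §1 + `hev₁` and the
knit's side conditions verbatim (`δ2LM₂R_h ≤ τD` in the cube distance, `h190p`, `h15`, `hX`/`hfar`, the γ-clause `11d²B₃γ² < α`, membership of
the plaquette data).  Print's case `Wf = U₀` is the instance `Wf := U₀`, `hWf := hU₀`, `h₀ := (hAG.le_U1 (hU₀ · ·))`.
[cite: Balaban1989LargeFieldI, (1.90)–(1.91) p.198; Balaban1985Variational, Prop. 9 (190) pp.308–309, (179)–(180) p.306, (73) p.289, (115) p.294] -/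
theorem ineq191_twoSup_layerW_concreteC {K : ℕ} (hK : K ≤ k₁) (hd1 : 1 ≤ d)
    (Reg : Regime 𝒢 0 W B₀ θ C₄ a₃ 𝔧 𝔞 ε₄) (hWa : AnalyticOnNhd ℂ W {Y : S → 𝔸 | ‖Y‖ < a₃})
    (H : (T → 𝔸) →L[ℂ] (S → 𝔸)) {B₀' : ℝ} (hB₀' : 0 ≤ B₀') (hH46 : ∀ X, ‖H X‖ ≤ B₀' * ‖X‖)
    {c1h ε₃ : ℝ} (hc1h : 1 ≤ c1h) (hε₃ : 0 < ε₃)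
    (h18 : 18 * ((8 * (131072 * ((d : ℝ) + 1) ^ 2) * Real.exp (4 * (800 * ((d : ℝ) + 1) ^ 2 * ((d : ℝ) + 4)) * α₁)) *
      ((L : ℝ) ^ K) ^ 2) * B₀' * d * c1h * ε₃ ≤ 1) (h2 : 2 * ε₃ ≤ b₁ / 2) (hnest : ε₄ + 𝔞 ≤ ε₃)
    {δ₀ B₁ : ℝ} (hδ₀ : 0 < δ₀) (hB₁ : 0 ≤ B₁)
    (hHker : ∀ (c'' : T) (Y : 𝔸) (s : S),
      ‖H (Pi.single c'' Y) s‖ ≤ B₁ * Real.exp (-(δ₀ * ((B7Prop1Explicit.l1 (loK L K c''.1.1 - s.1.1) : ℝ) / (L : ℝ) ^ K))) * ‖Y‖)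
    (hq : (C3Gen d L * (((L : ℝ) ^ K) ^ 2 * (2 * ε₃)) * (2 * d) * B₁ * Real.exp (2 * d * δ₀)) * (d * B6.c0 δ₀ (1 / 2) ^ d) < 1)
    -- the (1.90) tower of the free fine field `Wf` on the coarse bonds `T`; its field in the domain of (180)
    (dep : T → ℕ) (pt : T → B7Prop1Explicit.Site d) (dir : T → Fin d)
    (Wf : B7Prop1Explicit.Site d → Fin d → 𝔸ˣ) (hWf : ∀ x κ, Wf x κ ∈ G)
    (hB : ‖H₀ (fun i => mlog (((avgIter L Wf (K - dep i) (pt i) (dir i) *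
          (pullIter L (avgIter L Wf K) (dep i) (pt i) (dir i))⁻¹ : 𝔸ˣ) : 𝔸)))‖ < 𝔞 ∧
      ‖D2 (H₀ (fun i => mlog (((avgIter L Wf (K - dep i) (pt i) (dir i) *
          (pullIter L (avgIter L Wf K) (dep i) (pt i) (dir i))⁻¹ : 𝔸ˣ) : 𝔸))))‖ < 𝔧)
    -- the output presentation on the cube geometry; the consumer's background `U₀`
    (box : (cubeGeometry L K S T).Site → Finset (B7Prop1Explicit.Site d))
    (blk : B7Prop1Explicit.Site d → (cubeGeometry L K S T).Site)
    (y₀ : (cubeGeometry L K S T).Site) (Sc : (cubeGeometry L K S T).Site → Finset (B7Prop1Explicit.Site d × Fin d × Fin d)) {ξ : ℝ}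
    {U₀ : B7Prop1Explicit.Site d → Fin d → 𝔸ˣ}
    (ev : B7Prop1Explicit.Site d → ((S → 𝔸) →L[ℝ] (Fin d → 𝔸))) {b3 : BlockNorm (cubeGeometry L K S T) 𝒵}
    (hev : ∀ (y : (cubeGeometry L K S T).Site) (v : S → 𝔸), ∀ x ∈ box y,
      ‖ev x v‖ ≤ (supSize (cubeGeometry L K S T) (boxS L K S T) (blkS L K S T) : BlockNorm (cubeGeometry L K S T) (S → 𝔸)).loc y v)
    (hev₁ : ∀ (y : (cubeGeometry L K S T).Site) (v : S → 𝔸),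
      (covDerivBlockSize (cubeGeometry L K S T) y₀ Sc ξ U₀).loc y (fun x => ev x v) ≤
        (supSize (cubeGeometry L K S T) (boxS L K S T) (blkS L K S T) : BlockNorm (cubeGeometry L K S T) (S → 𝔸)).loc y v)
    {BG θW cΔ A₀ AH : ℝ} (hBG : 0 ≤ BG) (hθW : 0 ≤ θW) (hcΔ : 0 ≤ cΔ) (hA₀ : 0 ≤ A₀) (hAH : 0 ≤ AH)
    (hG190 : HasMaj b3 (supSize (cubeGeometry L K S T) (boxS L K S T) (blkS L K S T) : BlockNorm (cubeGeometry L K S T) (S → 𝔸))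
      (𝒢.restrictScalars ℝ : 𝒵 →ₗ[ℝ] (S → 𝔸)) (fun y y' => BG * Real.exp (-(δ₀ * (cubeGeometry L K S T).dist y y'))))
    (hD2H0 : HasMaj (supSize (cubeGeometry L K S T) (boxT L K S T) (blkT L K S T) : BlockNorm (cubeGeometry L K S T) (T → 𝔸)) b3
      ((D2 ∘L H₀).restrictScalars ℝ : (T → 𝔸) →ₗ[ℝ] 𝒵) (fun y y' => cΔ * Real.exp (-(δ₀ * (cubeGeometry L K S T).dist y y'))))
    (hH0 : HasMaj (supSize (cubeGeometry L K S T) (boxT L K S T) (blkT L K S T) : BlockNorm (cubeGeometry L K S T) (T → 𝔸))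
      (supSize (cubeGeometry L K S T) (boxS L K S T) (blkS L K S T) : BlockNorm (cubeGeometry L K S T) (S → 𝔸))
      (H₀.restrictScalars ℝ : (T → 𝔸) →ₗ[ℝ] (S → 𝔸)) (fun y y' => A₀ * Real.exp (-(δ₀ * (cubeGeometry L K S T).dist y y'))))
    (hH : HasMaj (supSize (cubeGeometry L K S T) (boxT L K S T) (blkT L K S T) : BlockNorm (cubeGeometry L K S T) (T → 𝔸))
      (supSize (cubeGeometry L K S T) (boxS L K S T) (blkS L K S T) : BlockNorm (cubeGeometry L K S T) (S → 𝔸))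
      (H.restrictScalars ℝ : (T → 𝔸) →ₗ[ℝ] (S → 𝔸)) (fun y y' => AH * Real.exp (-(δ₀ / 2 * (cubeGeometry L K S T).dist y y'))))
    (h189 : ∀ B' : T → 𝔸, ‖H₀ B'‖ < 𝔞 → ‖D2 (H₀ B')‖ < 𝔧 →
      Ineq189 (supSize (cubeGeometry L K S T) (boxS L K S T) (blkS L K S T) : BlockNorm (cubeGeometry L K S T) (S → 𝔸)) b3
        ((fderiv ℂ W (solA180 𝒢 W D2 H₀ ε₄ B' + H₀ B')).restrictScalars ℝ : (S → 𝔸) →ₗ[ℝ] 𝒵) θW δ₀)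
    (hqG : qG b3.κ 1 BG θW (B6.c0 δ₀ (1 / 8) ^ d) < 1)
    -- the [IV] side: the letters of `B15From190LayerSizes.ineq191_twoSup_of_ineq190_layerW` minus `h190₀,₁`, `hmv₀,₁`, `hdist`, `hrow`
    {α' τ Dd B₃ δ M₂ εh γ gh α : ℝ} {r R : ℕ}
    (hσ : 0 < α') (hτ : 0 ≤ τ) (hστ : α' * δ₀ + τ ≤ δ₀ / 8) (y : (cubeGeometry L K S T).Site) (hε : 0 < εh)
    (hs3 : C0 d * (εh * (1 / 2)) ≤ 1 / 3) (hs2 : 2 * (εh * (1 / 2)) ≤ c2' d L)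
    (hs : 11 * (d : ℝ) ^ 2 * (εh * (1 / 2)) ≤ 1 / 6) (lo hi : B7Prop1Explicit.Site d) (hlohi : lo ≤ hi)
    (h190p : pdevOn (tlo L lo K) (thi L hi K) Wf < εh * (1 / 2) * (((L : ℝ) ^ K)⁻¹) ^ 2)
    (h15 : ∀ n, n < K → ∀ z, tlo L lo n ≤ z → z ≤ thi L hi n → ∀ r : Fin d → Fin L,
      axialFn (avgIter L Wf (K - (n + 1))) ((L : ℤ) • z) ((L : ℤ) • z + boxVec L r) = 1)
    (hX : ∀ i, dep i ≤ K ∧ tlo L lo (dep i) ≤ pt i ∧ pt i + e (dir i) ≤ thi L hi (dep i))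
    (hfar : ∀ y' i, i ∈ boxT L K S T y' → Dd ≤ (cubeGeometry L K S T).dist y y')
    (hξ : 0 < ξ) (h₀ : ∀ z κ, U₀ z κ ∈ U1 𝔸) {Hf : B7Prop1Explicit.Site d → Fin d → 𝔸}
    (hHf : Hf = fun x => ev x (chartH179 𝒢 W D2 H₀
      (fun Y : S → 𝔸 => Y - H (Dfix (B11Eq44Concrete.Cmap L U₁ S T K) (H : (T → 𝔸) →ₗ[ℂ] (S → 𝔸))
        ((8 * (131072 * ((d : ℝ) + 1) ^ 2) * Real.exp (4 * (800 * ((d : ℝ) + 1) ^ 2 * ((d : ℝ) + 4)) * α₁)) *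
          ((L : ℝ) ^ K) ^ 2) Y)) ε₄
      (fun i => mlog (((avgIter L Wf (K - dep i) (pt i) (dir i) *
          (pullIter L (avgIter L Wf K) (dep i) (pt i) (dir i))⁻¹ : 𝔸ˣ) : 𝔸)))))
    (hsa : ∀ z κ, IsSelfAdjoint (Hf z κ))
    {g : B7Prop1Explicit.Site d → 𝔸ˣ} (hg : ∀ z, g z ∈ U1 𝔸) (μ ν : Fin d) (x : B7Prop1Explicit.Site d) {Linv : ℝ}
    (hgeom : δ * 2 * L * M₂ * R ≤ τ * Dd)
    (hCB : const190 1 1 b3.κ BG θW cΔ A₀ AH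
        (d * Real.exp (1 / 2 * d * δ₀) *
          ((1 - (C3Gen d L * (((L : ℝ) ^ K) ^ 2 * (2 * ε₃)) * (2 * d) * B₁ * Real.exp (2 * d * δ₀)) *
              (d * B6.c0 δ₀ (1 / 2) ^ d))⁻¹ * (Real.exp (d * δ₀) * (C3Gen d L * ((L : ℝ) ^ K) ^ 2 * (2 * ε₃)))))
        (B6.c0 δ₀ (1 / 8) ^ d) * B6.c0 δ₀ α' ^ d ≤ B₃) (hB₃ : 0 < B₃)
    (hr : 1 ≤ r) (hR : B14.IsRj L r gh R) (hgh : 0 < gh) (hgγ : gh ≤ γ) (hγe : 1 ≤ Real.log (γ ^ 2)⁻¹)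
    (hc1 : 1 < δ * 2 * L * M₂) (hRh : 0 < (R : ℝ)) (hγ : 11 * (d : ℝ) ^ 2 * B₃ * γ ^ 2 < α)
    (hx : x ∈ box y) (hxμ : x + e μ ∈ box y) (hxν : x + e ν ∈ box y)
    (hS₁ : (x, μ, ν) ∈ Sc y) (hS₂ : (x, ν, μ) ∈ Sc y) (hLinv : 0 ≤ Linv) :
    B15.PrelimIntegrations.Ineq191 ‖B8Ineq132.plaqF (gaugeAct g (B8Lemma1NonAbelian.mulCfg (B8Eq146AExpansion.expCfg
        (B8Eq146AExpansion.iEta ξ Hf)) U₀)) μ ν x - 1‖ ‖B8Ineq132.plaqF U₀ μ ν x - 1‖ (2 * α) Linv εh (εh * ξ ^ 2) := by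
  obtain ⟨h190₀, hmv₀⟩ := ineq190_and_hmv_supSize_concreteC_kernel L hL hAG k₁ U₁ hU₁ hα₁ hα₁3 hα₁4 h52₁ hb₁ hsmall₁ hc₃₁
    h145₁ h155₁ S T hK hd1 Reg hWa H hB₀' hH46 hc1h hε₃ h18 h2 hnest hδ₀ hB₁ hHker hq hB ev hev hBG hθW hcΔ hA₀ hAH hG190
    hD2H0 hH0 hH h189 hqG
    (fun B' => fun x => ev x (chartH179 𝒢 W D2 H₀
      (fun Y : S → 𝔸 => Y - H (Dfix (B11Eq44Concrete.Cmap L U₁ S T K) (H : (T → 𝔸) →ₗ[ℂ] (S → 𝔸))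
        ((8 * (131072 * ((d : ℝ) + 1) ^ 2) * Real.exp (4 * (800 * ((d : ℝ) + 1) ^ 2 * ((d : ℝ) + 4)) * α₁)) *
          ((L : ℝ) ^ K) ^ 2) Y)) ε₄ B'))
    (fun t => (LinearMap.pi fun x => ((ev x : (S → 𝔸) →L[ℝ] (Fin d → 𝔸)) : (S → 𝔸) →ₗ[ℝ] (Fin d → 𝔸))) ∘ₗ
      ((fderiv ℂ (chartH179 𝒢 W D2 H₀
        (fun Y : S → 𝔸 => Y - H (Dfix (B11Eq44Concrete.Cmap L U₁ S T K) (H : (T → 𝔸) →ₗ[ℂ] (S → 𝔸))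
          ((8 * (131072 * ((d : ℝ) + 1) ^ 2) * Real.exp (4 * (800 * ((d : ℝ) + 1) ^ 2 * ((d : ℝ) + 4)) * α₁)) *
            ((L : ℝ) ^ K) ^ 2) Y)) ε₄)
        ((t : ℝ) • (fun i => mlog (((avgIter L Wf (K - dep i) (pt i) (dir i) *
          (pullIter L (avgIter L Wf K) (dep i) (pt i) (dir i))⁻¹ : 𝔸ˣ) : 𝔸))))).restrictScalars ℝ :
            (T → 𝔸) →ₗ[ℝ] (S → 𝔸)))
    (fun _ => rfl) (fun _ => rfl) y
  obtain ⟨h190₁, hmv₁⟩ := B11Ineq190DerivConcreteC.ineq190_and_hmv_covDerivBlockSize_concreteC_kernel L hL hAG k₁ U₁ hU₁ hα₁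
    hα₁3 hα₁4 h52₁ hb₁ hsmall₁ hc₃₁ h145₁ h155₁ S T hK hd1 Reg hWa H hB₀' hH46 hc1h hε₃ h18 h2 hnest hδ₀ hB₁ hHker hq hB y₀ Sc
    ev hev₁ hBG hθW hcΔ hA₀ hAH hG190 hD2H0 hH0 hH h189 hqG
    (fun B' => fun x => ev x (chartH179 𝒢 W D2 H₀
      (fun Y : S → 𝔸 => Y - H (Dfix (B11Eq44Concrete.Cmap L U₁ S T K) (H : (T → 𝔸) →ₗ[ℂ] (S → 𝔸))
        ((8 * (131072 * ((d : ℝ) + 1) ^ 2) * Real.exp (4 * (800 * ((d : ℝ) + 1) ^ 2 * ((d : ℝ) + 4)) * α₁)) *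
          ((L : ℝ) ^ K) ^ 2) Y)) ε₄ B'))
    (fun t => (LinearMap.pi fun x => ((ev x : (S → 𝔸) →L[ℝ] (Fin d → 𝔸)) : (S → 𝔸) →ₗ[ℝ] (Fin d → 𝔸))) ∘ₗ
      ((fderiv ℂ (chartH179 𝒢 W D2 H₀
        (fun Y : S → 𝔸 => Y - H (Dfix (B11Eq44Concrete.Cmap L U₁ S T K) (H : (T → 𝔸) →ₗ[ℂ] (S → 𝔸))
          ((8 * (131072 * ((d : ℝ) + 1) ^ 2) * Real.exp (4 * (800 * ((d : ℝ) + 1) ^ 2 * ((d : ℝ) + 4)) * α₁)) *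
            ((L : ℝ) ^ K) ^ 2) Y)) ε₄)
        ((t : ℝ) • (fun i => mlog (((avgIter L Wf (K - dep i) (pt i) (dir i) *
          (pullIter L (avgIter L Wf K) (dep i) (pt i) (dir i))⁻¹ : 𝔸ˣ) : 𝔸))))).restrictScalars ℝ :
            (T → 𝔸) →ₗ[ℝ] (S → 𝔸)))
    (fun _ => rfl) (fun _ => rfl) y
  have hKc : 0 ≤ const190 1 1 b3.κ BG θW cΔ A₀ AH
      (d * Real.exp (1 / 2 * d * δ₀) *
        ((1 - (C3Gen d L * (((L : ℝ) ^ K) ^ 2 * (2 * ε₃)) * (2 * d) * B₁ * Real.exp (2 * d * δ₀)) *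
            (d * B6.c0 δ₀ (1 / 2) ^ d))⁻¹ * (Real.exp (d * δ₀) * (C3Gen d L * ((L : ℝ) ^ K) ^ 2 * (2 * ε₃)))))
      (B6.c0 δ₀ (1 / 8) ^ d) :=
    const190_nonneg' zero_le_one zero_le_one b3.κ_nonneg (c0_pow_nonneg δ₀ (1 / 8) d) hBG hθW hcΔ hA₀ hAH
      (thetaD_nonneg hε₃.le hq) hqG
  have hrow : RowSum (cubeGeometry L K S T) (α' * δ₀) (B6.c0 δ₀ α' ^ d) := rowSum_cubeGeometry L K S T (mul_pos hσ hδ₀)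
  subst hHf
  exact ineq191_twoSup_of_ineq190_layerW (boxT L K S T) (blkT L K S T) dep pt dir box blk y₀ Sc h190₀ h190₁ hKc
    (dist_nonneg_cubeGeometry L K S T) hrow hτ hστ y hL hd1 hAG Wf hWf hε hs3 hs2 hs lo hi hlohi h190p h15 hX hfar hξ h₀ hsa hg μ
    ν x hmv₀ hmv₁ hgeom hCB hB₃ hr hR hgh hgγ hγe hc1 hRh hγ hx hxμ hxν hS₁ hS₂ hLinv

end Eq191C

/-! ## §6 (v1.1) (1.45)–(1.48) at the concrete `C_j`: the (1.44) top-bond field on `T`, print's WEIGHTED output sizes through the weighted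
presentation `(L^iη) • ev` (sup pair from r08's kernel theorem, weighted first-order pair from `B11Ineq190DerivConcreteC`) -/

section WeightedC

variable {𝔸 : Type} [CStarAlgebra 𝔸] [Nontrivial 𝔸]

variable (L : ℕ) (hL : 2 ≤ L) {G : Subgroup 𝔸ˣ} (hAG : AvgClosed d L G) (k₁ : ℕ)
  (U₁ : B7Prop1Explicit.Site d → Fin d → 𝔸ˣ) (hU₁ : ∀ x κ, U₁ x κ ∈ G) {α₁ : ℝ} (hα₁ : 0 < α₁)
  (hα₁3 : C0 d * α₁ ≤ 1 / 3) (hα₁4 : 4 * α₁ ≤ c2' d L) (h52₁ : pdev U₁ < α₁ * (((L : ℝ) ^ k₁)⁻¹) ^ 2)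
  {b₁ : ℝ} (hb₁ : 0 < b₁)
  (hsmall₁ : Real.exp (4 * (800 * ((d : ℝ) + 1) ^ 2 * ((d : ℝ) + 4)) * α₁)
    * (1 + 8 * (131072 * ((d : ℝ) + 1) ^ 2) * ((L : ℝ) ^ k₁ * b₁)) ≤ 2)
  (hc₃₁ : 4 * ((L : ℝ) ^ k₁ * b₁) < c3 d L)
  (h145₁ : 8 * d * thetaGen d L α₁ * (L : ℝ)⁻¹ ^ 4 ≤ 1)
  (h155₁ : (2 * (L : ℝ) - 1) * (L : ℝ)⁻¹ ^ 2 + 2 * d * thetaGen d L α₁ * (L : ℝ)⁻¹ ^ 3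
    + 1 / 8 * (1 + 2 * d * thetaGen d L α₁ * (L : ℝ)⁻¹ ^ 2 + 2 * d * C3Gen d L * ((L : ℝ) ^ k₁ * b₁)) * (L : ℝ)⁻¹ ^ 2 ≤ 1)
  (S T : Finset (B7Prop1Explicit.Site d × Fin d))

variable {𝒵 : Type} [NormedAddCommGroup 𝒵] [NormedSpace ℂ 𝒵] [CompleteSpace 𝒵]
  {𝒢 : 𝒵 →L[ℂ] (S → 𝔸)} {W : (S → 𝔸) → 𝒵} {D2 : (S → 𝔸) →L[ℂ] 𝒵} {H₀ : (T → 𝔸) →L[ℂ] (S → 𝔸)} {B₀ θ C₄ a₃ 𝔧 𝔞 ε₄ : ℝ}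

include hL hAG hU₁ hα₁ hα₁3 hα₁4 h52₁ hb₁ hsmall₁ hc₃₁ h145₁ h155₁ in
/-- **(1.46) ⇒ (1.48) ON THE LATTICE MODEL, AT THE CONCRETE `C_j(U₁, ·)` OF [4] ON THE SINGLE-SCALE CUBE GEOMETRY** — r12's
`B15From190LayerSizes.ineq148_of_ineq190_layer` (the (1.44) field `i ↦ log[V_j(b_i)(V_Z^{(j)}(b_i))⁻¹]` on the top bonds `b_i`, HERE INDEXED BY THE
COARSE BONDS `T`; B-size `4δ′_j` from (1.27) and localisation discharged there; output sizes WITH PRINT'S WEIGHTS (1.45) *"sup_{B^i(y)} L^iη|ℍ|,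
sup_{B^i(y)} (L^iη)²|∇^η ℍ|"*: `supSize … box blk` and `ofSeminorms … y₀ (L^iη · covDerivSize (Sc ·) η U₀)` at the rescaled function `(L^iη) • ℍ`)
with BOTH pairs SUPPLIED BY NAME through the WEIGHTED presentation `x ↦ (L^iη) • ev x`: `h190₀`/`hmv₀` from r08's
`B11Ineq73HasMajConcrete.ineq190_and_hmv_supSize_concreteC_kernel`, `h190₁`/`hmv₁` from r12's `B11Ineq190DerivConcreteC.ineq190_and_hmv_ofSeminorms_concreteC_kernel`
(compatibility letters `hevw`/`hevw₁` against the sup size of the fine bonds); (190), mean value, (73), (2.54), (2.61) at `⅛δ₀`, `hN`/`hBloc`,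
`hTm`/`hTm0` DISCHARGED; the knit's own (2.61) at `σ = αδ₀` is `rowSum_cubeGeometry`, and the (190) constant `C` of the knit's γ-clauses is the
explicit `const190 1 1 κ₃ … θ_𝔇 c₀(δ₀,⅛)ᵈ` of the cube geometry.  Remaining: as in §1 + the knit's side conditions verbatim ((1.27) `h127`, `2δ′_j ≤
½`, `hX`/`hfar`, the (1.47) distance input `hgeo` and `δ(M/M₁) ≥ 2` as `hM` in the cube distance, the flow/profile letters, the γ-clauses).
[cite: Balaban1989LargeFieldI, (1.44)–(1.48) p.186, (1.27) p.182; Balaban1985Variational, Prop. 9 (190) pp.308–309, (179)–(180) p.306, (73) p.289, (115) p.294] -/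
theorem ineq148_layer_concreteC {j : ℕ} (hj : j ≤ k₁) (hd1 : 1 ≤ d)
    (Reg : Regime 𝒢 0 W B₀ θ C₄ a₃ 𝔧 𝔞 ε₄) (hWa : AnalyticOnNhd ℂ W {Y : S → 𝔸 | ‖Y‖ < a₃})
    (H : (T → 𝔸) →L[ℂ] (S → 𝔸)) {B₀' : ℝ} (hB₀' : 0 ≤ B₀') (hH46 : ∀ X, ‖H X‖ ≤ B₀' * ‖X‖)
    {c1h ε₃ : ℝ} (hc1h : 1 ≤ c1h) (hε₃ : 0 < ε₃)
    (h18 : 18 * ((8 * (131072 * ((d : ℝ) + 1) ^ 2) * Real.exp (4 * (800 * ((d : ℝ) + 1) ^ 2 * ((d : ℝ) + 4)) * α₁)) *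
      ((L : ℝ) ^ j) ^ 2) * B₀' * d * c1h * ε₃ ≤ 1) (h2 : 2 * ε₃ ≤ b₁ / 2) (hnest : ε₄ + 𝔞 ≤ ε₃)
    {δ₀ B₁ : ℝ} (hδ₀ : 0 < δ₀) (hB₁ : 0 ≤ B₁)
    (hHker : ∀ (c'' : T) (Y : 𝔸) (s : S),
      ‖H (Pi.single c'' Y) s‖ ≤ B₁ * Real.exp (-(δ₀ * ((B7Prop1Explicit.l1 (loK L j c''.1.1 - s.1.1) : ℝ) / (L : ℝ) ^ j))) * ‖Y‖)
    (hq : (C3Gen d L * (((L : ℝ) ^ j) ^ 2 * (2 * ε₃)) * (2 * d) * B₁ * Real.exp (2 * d * δ₀)) * (d * B6.c0 δ₀ (1 / 2) ^ d) < 1)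
    -- the (1.44) field on the top bonds `b_i = ⟨pt i, pt i + e_{dir i}⟩`, `i ∈ T` (`V = V_j`, `A = V_Z^{(j)}`), in the domain of (180)
    (pt : T → B7Prop1Explicit.Site d) (dir : T → Fin d) (A V : B7Prop1Explicit.Site d → Fin d → 𝔸ˣ)
    (hB : ‖H₀ (fun i => mlog (((V (pt i) (dir i) * (A (pt i) (dir i))⁻¹ : 𝔸ˣ) : 𝔸)))‖ < 𝔞 ∧
      ‖D2 (H₀ (fun i => mlog (((V (pt i) (dir i) * (A (pt i) (dir i))⁻¹ : 𝔸ˣ) : 𝔸))))‖ < 𝔧)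
    -- weight `L^iη = Lpow * η` and the weighted presentation on the cube geometry
    (box : (cubeGeometry L j S T).Site → Finset (B7Prop1Explicit.Site d))
    (blk : B7Prop1Explicit.Site d → (cubeGeometry L j S T).Site)
    (y₀ : (cubeGeometry L j S T).Site) (Sc : (cubeGeometry L j S T).Site → Finset (B7Prop1Explicit.Site d × Fin d × Fin d))
    {η Lpow : ℝ} {U₀ : B7Prop1Explicit.Site d → Fin d → 𝔸ˣ}
    (ev : B7Prop1Explicit.Site d → ((S → 𝔸) →L[ℝ] (Fin d → 𝔸))) {b3 : BlockNorm (cubeGeometry L j S T) 𝒵}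
    (hevw : ∀ (y : (cubeGeometry L j S T).Site) (v : S → 𝔸), ∀ x ∈ box y,
      ‖((Lpow * η) • ev x) v‖ ≤ (supSize (cubeGeometry L j S T) (boxS L j S T) (blkS L j S T) : BlockNorm (cubeGeometry L j S T) (S → 𝔸)).loc y v)
    (hevw₁ : ∀ (y : (cubeGeometry L j S T).Site) (v : S → 𝔸),
      (ofSeminorms (cubeGeometry L j S T) y₀ (fun y => (Lpow * η).toNNReal • covDerivSize (Sc y) η U₀)).loc y
          (fun x => ((Lpow * η) • ev x) v) ≤
        (supSize (cubeGeometry L j S T) (boxS L j S T) (blkS L j S T) : BlockNorm (cubeGeometry L j S T) (S → 𝔸)).loc y v)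
    {BG θW cΔ A₀ AH : ℝ} (hBG : 0 ≤ BG) (hθW : 0 ≤ θW) (hcΔ : 0 ≤ cΔ) (hA₀ : 0 ≤ A₀) (hAH : 0 ≤ AH)
    (hG190 : HasMaj b3 (supSize (cubeGeometry L j S T) (boxS L j S T) (blkS L j S T) : BlockNorm (cubeGeometry L j S T) (S → 𝔸))
      (𝒢.restrictScalars ℝ : 𝒵 →ₗ[ℝ] (S → 𝔸)) (fun y y' => BG * Real.exp (-(δ₀ * (cubeGeometry L j S T).dist y y'))))
    (hD2H0 : HasMaj (supSize (cubeGeometry L j S T) (boxT L j S T) (blkT L j S T) : BlockNorm (cubeGeometry L j S T) (T → 𝔸)) b3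
      ((D2 ∘L H₀).restrictScalars ℝ : (T → 𝔸) →ₗ[ℝ] 𝒵) (fun y y' => cΔ * Real.exp (-(δ₀ * (cubeGeometry L j S T).dist y y'))))
    (hH0 : HasMaj (supSize (cubeGeometry L j S T) (boxT L j S T) (blkT L j S T) : BlockNorm (cubeGeometry L j S T) (T → 𝔸))
      (supSize (cubeGeometry L j S T) (boxS L j S T) (blkS L j S T) : BlockNorm (cubeGeometry L j S T) (S → 𝔸))
      (H₀.restrictScalars ℝ : (T → 𝔸) →ₗ[ℝ] (S → 𝔸)) (fun y y' => A₀ * Real.exp (-(δ₀ * (cubeGeometry L j S T).dist y y'))))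
    (hH : HasMaj (supSize (cubeGeometry L j S T) (boxT L j S T) (blkT L j S T) : BlockNorm (cubeGeometry L j S T) (T → 𝔸))
      (supSize (cubeGeometry L j S T) (boxS L j S T) (blkS L j S T) : BlockNorm (cubeGeometry L j S T) (S → 𝔸))
      (H.restrictScalars ℝ : (T → 𝔸) →ₗ[ℝ] (S → 𝔸)) (fun y y' => AH * Real.exp (-(δ₀ / 2 * (cubeGeometry L j S T).dist y y'))))
    (h189 : ∀ B' : T → 𝔸, ‖H₀ B'‖ < 𝔞 → ‖D2 (H₀ B')‖ < 𝔧 →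
      Ineq189 (supSize (cubeGeometry L j S T) (boxS L j S T) (blkS L j S T) : BlockNorm (cubeGeometry L j S T) (S → 𝔸)) b3
        ((fderiv ℂ W (solA180 𝒢 W D2 H₀ ε₄ B' + H₀ B')).restrictScalars ℝ : (S → 𝔸) →ₗ[ℝ] 𝒵) θW δ₀)
    (hqG : qG b3.κ 1 BG θW (B6.c0 δ₀ (1 / 8) ^ d) < 1)
    -- the [IV] side: the letters of `B15From190LayerSizes.ineq148_of_ineq190_layer` minus `h190₀,₁`, `hmv₀,₁`, `hC`, `hc`, `hdist`, `hrow`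
    {α' τ δ'j Dd : ℝ} (hσ : 0 < α') (hτ : 0 ≤ τ) (hστ : α' * δ₀ + τ ≤ δ₀ / 8) (y : (cubeGeometry L j S T).Site)
    (hδ'j : 0 ≤ δ'j) (hδ2 : 2 * δ'j ≤ 1 / 2) (lo hi : B7Prop1Explicit.Site d)
    (h127 : ∀ x ν, lo ≤ x → x + e ν ≤ hi → ‖((V x ν * (A x ν)⁻¹ : 𝔸ˣ) : 𝔸) - 1‖ < 2 * δ'j)
    (hX : ∀ i, lo ≤ pt i ∧ pt i + e (dir i) ≤ hi)
    (hfar : ∀ y' i, i ∈ boxT L j S T y' → Dd ≤ (cubeGeometry L j S T).dist y y')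
    (hη : 0 < η) (h₀ : ∀ z κ, U₀ z κ ∈ U1 𝔸)
    {Hf : B7Prop1Explicit.Site d → Fin d → 𝔸}
    (hHf : Hf = fun x => ev x (chartH179 𝒢 W D2 H₀
      (fun Y : S → 𝔸 => Y - H (Dfix (B11Eq44Concrete.Cmap L U₁ S T j) (H : (T → 𝔸) →ₗ[ℂ] (S → 𝔸))
        ((8 * (131072 * ((d : ℝ) + 1) ^ 2) * Real.exp (4 * (800 * ((d : ℝ) + 1) ^ 2 * ((d : ℝ) + 4)) * α₁)) *
          ((L : ℝ) ^ j) ^ 2) Y)) ε₄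
      (fun i => mlog (((V (pt i) (dir i) * (A (pt i) (dir i))⁻¹ : 𝔸ˣ) : 𝔸)))))
    (hsa : ∀ z κ, IsSelfAdjoint (Hf z κ))
    {g : B7Prop1Explicit.Site d → 𝔸ˣ} (hg : ∀ z, g z ∈ U1 𝔸) (μ ν : Fin d) (x : B7Prop1Explicit.Site d)
    {β₀ εi εj Linv γ gj A₀' A₁ M M₁ α β : ℝ} {i j' p₀ p₁ : ℕ}
    (hx : x ∈ box y) (hxμ : x + e μ ∈ box y) (hxν : x + e ν ∈ box y)
    (hS₁ : (x, μ, ν) ∈ Sc y) (hS₂ : (x, ν, μ) ∈ Sc y)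
    (hLL : Lpow * Linv = 1) (hLinv : 0 ≤ Linv) (hLinv1 : Linv ≤ 1)
    (hdist0 : 0 ≤ τ * Dd)
    (hsmallγ : 128 * (const190 1 1 b3.κ BG θW cΔ A₀ AH
        (d * Real.exp (1 / 2 * d * δ₀) *
          ((1 - (C3Gen d L * (((L : ℝ) ^ j) ^ 2 * (2 * ε₃)) * (2 * d) * B₁ * Real.exp (2 * d * δ₀)) *
              (d * B6.c0 δ₀ (1 / 2) ^ d))⁻¹ * (Real.exp (d * δ₀) * (C3Gen d L * ((L : ℝ) ^ j) ^ 2 * (2 * ε₃)))))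
        (B6.c0 δ₀ (1 / 8) ^ d) * B6.c0 δ₀ α' ^ d) * (A₁ * (4 * (p₁ : ℝ)) ^ p₁ * Real.sqrt γ) ≤ 1)
    (hflow : εj ≤ (1 + β₀) * (1 + ((j' - i : ℕ) : ℝ) ^ (1 / 2 : ℝ)) * εi) (hεi : 0 ≤ εi)
    (hA₀' : 0 < A₀') (hA₁ : 0 ≤ A₁) (hβ₀ : 0 ≤ 1 + β₀)
    (hδ' : δ'j = gj * A₁ * logPow p₁ gj) (hεj : εj = gj * A₀' * logPow p₀ gj)
    (hgeo : i < j' → M / M₁ * ((j' - i : ℕ) : ℝ) ≤ Dd) (hM : 2 ≤ τ * (M / M₁))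
    (hp : p₁ < p₀) (hgj : 0 < gj) (hgjγ : gj ≤ γ) (hγe : 1 ≤ Real.log (γ ^ 2)⁻¹)
    (hγ₁ : 9 * (const190 1 1 b3.κ BG θW cΔ A₀ AH
        (d * Real.exp (1 / 2 * d * δ₀) *
          ((1 - (C3Gen d L * (((L : ℝ) ^ j) ^ 2 * (2 * ε₃)) * (2 * d) * B₁ * Real.exp (2 * d * δ₀)) *
              (d * B6.c0 δ₀ (1 / 2) ^ d))⁻¹ * (Real.exp (d * δ₀) * (C3Gen d L * ((L : ℝ) ^ j) ^ 2 * (2 * ε₃)))))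
        (B6.c0 δ₀ (1 / 8) ^ d) * B6.c0 δ₀ α' ^ d) * (A₁ / A₀') * (Real.log (γ ^ 2)⁻¹)⁻¹ * (1 + β₀) ≤ α * β)
    (hδ'γ : δ'j ≤ A₁ * (4 * (p₁ : ℝ)) ^ p₁ * Real.sqrt γ)
    (hγ₂ : 8 * (const190 1 1 b3.κ BG θW cΔ A₀ AH
        (d * Real.exp (1 / 2 * d * δ₀) *
          ((1 - (C3Gen d L * (((L : ℝ) ^ j) ^ 2 * (2 * ε₃)) * (2 * d) * B₁ * Real.exp (2 * d * δ₀)) *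
              (d * B6.c0 δ₀ (1 / 2) ^ d))⁻¹ * (Real.exp (d * δ₀) * (C3Gen d L * ((L : ℝ) ^ j) ^ 2 * (2 * ε₃)))))
        (B6.c0 δ₀ (1 / 8) ^ d) * B6.c0 δ₀ α' ^ d) * (A₁ * (4 * (p₁ : ℝ)) ^ p₁ * Real.sqrt γ) ≤ α * β) :
    B15.BasicStep.Ineq148 ‖B8Ineq132.plaqF (gaugeAct g (B8Lemma1NonAbelian.mulCfg (B8Eq146AExpansion.expCfg
        (B8Eq146AExpansion.iEta η Hf)) U₀)) μ ν x - 1‖ ‖B8Ineq132.plaqF U₀ μ ν x - 1‖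
      α β ((1 / 2 : ℝ) ^ (j' - i)) (εi * Linv ^ 2) := by
  -- the weighted presentation `x ↦ (L^iη) • ev x`; the presented weighted function is `(L^iη) • ℍ`
  obtain ⟨h190₀, hmv₀⟩ := ineq190_and_hmv_supSize_concreteC_kernel L hL hAG k₁ U₁ hU₁ hα₁ hα₁3 hα₁4 h52₁ hb₁ hsmall₁ hc₃₁
    h145₁ h155₁ S T hj hd1 Reg hWa H hB₀' hH46 hc1h hε₃ h18 h2 hnest hδ₀ hB₁ hHker hq hB (fun x => (Lpow * η) • ev x) hevw hBG
    hθW hcΔ hA₀ hAH hG190 hD2H0 hH0 hH h189 hqG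
    (fun B' => (Lpow * η) • fun x => ev x (chartH179 𝒢 W D2 H₀
      (fun Y : S → 𝔸 => Y - H (Dfix (B11Eq44Concrete.Cmap L U₁ S T j) (H : (T → 𝔸) →ₗ[ℂ] (S → 𝔸))
        ((8 * (131072 * ((d : ℝ) + 1) ^ 2) * Real.exp (4 * (800 * ((d : ℝ) + 1) ^ 2 * ((d : ℝ) + 4)) * α₁)) *
          ((L : ℝ) ^ j) ^ 2) Y)) ε₄ B'))
    (fun t => (LinearMap.pi fun x => (((Lpow * η) • ev x : (S → 𝔸) →L[ℝ] (Fin d → 𝔸)) : (S → 𝔸) →ₗ[ℝ] (Fin d → 𝔸))) ∘ₗ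
      ((fderiv ℂ (chartH179 𝒢 W D2 H₀
        (fun Y : S → 𝔸 => Y - H (Dfix (B11Eq44Concrete.Cmap L U₁ S T j) (H : (T → 𝔸) →ₗ[ℂ] (S → 𝔸))
          ((8 * (131072 * ((d : ℝ) + 1) ^ 2) * Real.exp (4 * (800 * ((d : ℝ) + 1) ^ 2 * ((d : ℝ) + 4)) * α₁)) *
            ((L : ℝ) ^ j) ^ 2) Y)) ε₄)
        ((t : ℝ) • (fun i => mlog (((V (pt i) (dir i) * (A (pt i) (dir i))⁻¹ : 𝔸ˣ) : 𝔸))))).restrictScalars ℝ :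
          (T → 𝔸) →ₗ[ℝ] (S → 𝔸)))
    (fun _ => rfl) (fun _ => rfl) y
  obtain ⟨h190₁, hmv₁⟩ := B11Ineq190DerivConcreteC.ineq190_and_hmv_ofSeminorms_concreteC_kernel L hL hAG k₁ U₁ hU₁ hα₁ hα₁3
    hα₁4 h52₁ hb₁ hsmall₁ hc₃₁ h145₁ h155₁ S T hj hd1 Reg hWa H hB₀' hH46 hc1h hε₃ h18 h2 hnest hδ₀ hB₁ hHker hq hB y₀ Sc
    (fun x => (Lpow * η) • ev x) (Lpow * η).toNNReal hevw₁ hBG hθW hcΔ hA₀ hAH hG190 hD2H0 hH0 hH h189 hqG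
    (fun B' => (Lpow * η) • fun x => ev x (chartH179 𝒢 W D2 H₀
      (fun Y : S → 𝔸 => Y - H (Dfix (B11Eq44Concrete.Cmap L U₁ S T j) (H : (T → 𝔸) →ₗ[ℂ] (S → 𝔸))
        ((8 * (131072 * ((d : ℝ) + 1) ^ 2) * Real.exp (4 * (800 * ((d : ℝ) + 1) ^ 2 * ((d : ℝ) + 4)) * α₁)) *
          ((L : ℝ) ^ j) ^ 2) Y)) ε₄ B'))
    (fun t => (LinearMap.pi fun x => (((Lpow * η) • ev x : (S → 𝔸) →L[ℝ] (Fin d → 𝔸)) : (S → 𝔸) →ₗ[ℝ] (Fin d → 𝔸))) ∘ₗ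
      ((fderiv ℂ (chartH179 𝒢 W D2 H₀
        (fun Y : S → 𝔸 => Y - H (Dfix (B11Eq44Concrete.Cmap L U₁ S T j) (H : (T → 𝔸) →ₗ[ℂ] (S → 𝔸))
          ((8 * (131072 * ((d : ℝ) + 1) ^ 2) * Real.exp (4 * (800 * ((d : ℝ) + 1) ^ 2 * ((d : ℝ) + 4)) * α₁)) *
            ((L : ℝ) ^ j) ^ 2) Y)) ε₄)
        ((t : ℝ) • (fun i => mlog (((V (pt i) (dir i) * (A (pt i) (dir i))⁻¹ : 𝔸ˣ) : 𝔸))))).restrictScalars ℝ :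
          (T → 𝔸) →ₗ[ℝ] (S → 𝔸)))
    (fun _ => rfl) (fun _ => rfl) y
  have hK : 0 ≤ const190 1 1 b3.κ BG θW cΔ A₀ AH
      (d * Real.exp (1 / 2 * d * δ₀) *
        ((1 - (C3Gen d L * (((L : ℝ) ^ j) ^ 2 * (2 * ε₃)) * (2 * d) * B₁ * Real.exp (2 * d * δ₀)) *
            (d * B6.c0 δ₀ (1 / 2) ^ d))⁻¹ * (Real.exp (d * δ₀) * (C3Gen d L * ((L : ℝ) ^ j) ^ 2 * (2 * ε₃)))))
      (B6.c0 δ₀ (1 / 8) ^ d) :=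
    const190_nonneg' zero_le_one zero_le_one b3.κ_nonneg (c0_pow_nonneg δ₀ (1 / 8) d) hBG hθW hcΔ hA₀ hAH
      (thetaD_nonneg hε₃.le hq) hqG
  have hrow : RowSum (cubeGeometry L j S T) (α' * δ₀) (B6.c0 δ₀ α' ^ d) := rowSum_cubeGeometry L j S T (mul_pos hσ hδ₀)
  subst hHf
  exact ineq148_of_ineq190_layer (boxT L j S T) (blkT L j S T) pt dir box blk y₀ Sc h190₀ h190₁ hK (dist_nonneg_cubeGeometry L j S T)
    hrow hτ hστ y A V hδ'j hδ2 lo hi h127 hX hfar hη h₀ hsa hg μ ν x hmv₀ hmv₁ hx hxμ hxν hS₁ hS₂ hLL hLinv hLinv1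
    (c0_pow_nonneg δ₀ α' d) hdist0 hsmallγ hflow hεi hA₀' hA₁ hβ₀ hδ' hεj hgeo hM hp hgj hgjγ hγe hγ₁ hδ'γ hγ₂

end WeightedC

/-! ## §7 (v1.1) (1.96) at the concrete `C_K`: chain 1 (= (1.90)/(1.91)) with both pairs from the concrete theorems, chain 2 through the
printed (1.94) -/

section Eq196C

variable {𝔸 : Type} [CStarAlgebra 𝔸] [Nontrivial 𝔸]

variable (L : ℕ) (hL : 2 ≤ L) {G : Subgroup 𝔸ˣ} (hAG : AvgClosed d L G) (k₁ : ℕ)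
  (U₁ : B7Prop1Explicit.Site d → Fin d → 𝔸ˣ) (hU₁ : ∀ x κ, U₁ x κ ∈ G) {α₁ : ℝ} (hα₁ : 0 < α₁)
  (hα₁3 : C0 d * α₁ ≤ 1 / 3) (hα₁4 : 4 * α₁ ≤ c2' d L) (h52₁ : pdev U₁ < α₁ * (((L : ℝ) ^ k₁)⁻¹) ^ 2)
  {b₁ : ℝ} (hb₁ : 0 < b₁)
  (hsmall₁ : Real.exp (4 * (800 * ((d : ℝ) + 1) ^ 2 * ((d : ℝ) + 4)) * α₁)
    * (1 + 8 * (131072 * ((d : ℝ) + 1) ^ 2) * ((L : ℝ) ^ k₁ * b₁)) ≤ 2)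
  (hc₃₁ : 4 * ((L : ℝ) ^ k₁ * b₁) < c3 d L)
  (h145₁ : 8 * d * thetaGen d L α₁ * (L : ℝ)⁻¹ ^ 4 ≤ 1)
  (h155₁ : (2 * (L : ℝ) - 1) * (L : ℝ)⁻¹ ^ 2 + 2 * d * thetaGen d L α₁ * (L : ℝ)⁻¹ ^ 3
    + 1 / 8 * (1 + 2 * d * thetaGen d L α₁ * (L : ℝ)⁻¹ ^ 2 + 2 * d * C3Gen d L * ((L : ℝ) ^ k₁ * b₁)) * (L : ℝ)⁻¹ ^ 2 ≤ 1)
  (S T : Finset (B7Prop1Explicit.Site d × Fin d))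

variable {𝒵 : Type} [NormedAddCommGroup 𝒵] [NormedSpace ℂ 𝒵] [CompleteSpace 𝒵]
  {𝒢 : 𝒵 →L[ℂ] (S → 𝔸)} {W : (S → 𝔸) → 𝒵} {D2 : (S → 𝔸) →L[ℂ] 𝒵} {H₀ : (T → 𝔸) →L[ℂ] (S → 𝔸)} {B₀ θ C₄ a₃ 𝔧 𝔞 ε₄ : ℝ}

include hL hAG hU₁ hα₁ hα₁3 hα₁4 h52₁ hb₁ hsmall₁ hc₃₁ h145₁ h155₁ in
/-- **(1.96) p. 199 ON THE LATTICE, AT THE CONCRETE `C_K(U₁, ·)` OF [4] ON THE SINGLE-SCALE CUBE GEOMETRY: chain 1 with BOTH pairs SUPPLIED by the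
concrete theorems, chain 2 FROM THE PRINTED (1.94)** — r12's `B15From190LayerSizes.ineq196_twoSup_of_ineq190_layer` (chain 1 = `ℍ₁ = ℍ_{h,□}` of
(1.90) over `Uhb := U_{h,□}(V″)`, argument field = the (1.90) tower field of the free fine field `Wf` on the coarse bonds `T`; chain 2 = `ℍ₂` of
(1.93) entering EXACTLY through the printed bound (1.94) `hB₁`–`hB₄`, `hBD₁`, `hBD₂`, `hY₂`) with `h190₀`/`hmv₀` from r08's sup kernel theorem and
`h190₁`/`hmv₁` (covariant derivatives at `Uhb`) from r12's covariant twin; (190), mean value, (73), (2.54), (2.61) at `⅛δ₀`, `hN`/`hBloc`, `hTm`/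
`hTm0` DISCHARGED.  Remaining: as in §1 + the knit's side conditions verbatim (`h190p`, `h15`, `hX`/`hfar`, `δ2LM₂R_h ≤ τD` in the cube distance,
the γ-clause `11d²B₃γ² < 1/24`, the χ_{h,1/2}-restriction `hhalf`, `β ≤ ¼`, `ε_h ≤ 1/10`, `t ∈ (0,1]`, membership of the plaquette data).
[cite: Balaban1989LargeFieldI, (1.90)–(1.96) pp.198–199; Balaban1985Variational, Prop. 9 (190) pp.308–309, (179)–(180) p.306, (73) p.289, (115) p.294] -/
theorem ineq196_twoSup_layer_concreteC {K : ℕ} (hK : K ≤ k₁) (hd1 : 1 ≤ d)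
    (Reg : Regime 𝒢 0 W B₀ θ C₄ a₃ 𝔧 𝔞 ε₄) (hWa : AnalyticOnNhd ℂ W {Y : S → 𝔸 | ‖Y‖ < a₃})
    (H : (T → 𝔸) →L[ℂ] (S → 𝔸)) {B₀' : ℝ} (hB₀' : 0 ≤ B₀') (hH46 : ∀ X, ‖H X‖ ≤ B₀' * ‖X‖)
    {c1h ε₃ : ℝ} (hc1h : 1 ≤ c1h) (hε₃ : 0 < ε₃)
    (h18 : 18 * ((8 * (131072 * ((d : ℝ) + 1) ^ 2) * Real.exp (4 * (800 * ((d : ℝ) + 1) ^ 2 * ((d : ℝ) + 4)) * α₁)) *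
      ((L : ℝ) ^ K) ^ 2) * B₀' * d * c1h * ε₃ ≤ 1) (h2 : 2 * ε₃ ≤ b₁ / 2) (hnest : ε₄ + 𝔞 ≤ ε₃)
    {δ₀ B₁ : ℝ} (hδ₀ : 0 < δ₀) (hB₁ : 0 ≤ B₁)
    (hHker : ∀ (c'' : T) (Y : 𝔸) (s : S),
      ‖H (Pi.single c'' Y) s‖ ≤ B₁ * Real.exp (-(δ₀ * ((B7Prop1Explicit.l1 (loK L K c''.1.1 - s.1.1) : ℝ) / (L : ℝ) ^ K))) * ‖Y‖)
    (hq : (C3Gen d L * (((L : ℝ) ^ K) ^ 2 * (2 * ε₃)) * (2 * d) * B₁ * Real.exp (2 * d * δ₀)) * (d * B6.c0 δ₀ (1 / 2) ^ d) < 1)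
    -- chain 1's argument field: the (1.90) tower of `Wf` on the coarse bonds `T`, `K` levels, in the domain of (180)
    (dep : T → ℕ) (pt : T → B7Prop1Explicit.Site d) (dir : T → Fin d)
    (Wf : B7Prop1Explicit.Site d → Fin d → 𝔸ˣ) (hWf : ∀ x κ, Wf x κ ∈ G)
    (hB : ‖H₀ (fun i => mlog (((avgIter L Wf (K - dep i) (pt i) (dir i) *
          (pullIter L (avgIter L Wf K) (dep i) (pt i) (dir i))⁻¹ : 𝔸ˣ) : 𝔸)))‖ < 𝔞 ∧
      ‖D2 (H₀ (fun i => mlog (((avgIter L Wf (K - dep i) (pt i) (dir i) *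
          (pullIter L (avgIter L Wf K) (dep i) (pt i) (dir i))⁻¹ : 𝔸ˣ) : 𝔸))))‖ < 𝔧)
    -- presentation on the cube geometry; chain 1's background `Uhb = U_{h,□}(V″)`
    (box : (cubeGeometry L K S T).Site → Finset (B7Prop1Explicit.Site d))
    (blk : B7Prop1Explicit.Site d → (cubeGeometry L K S T).Site)
    (y₀ : (cubeGeometry L K S T).Site) (Sc : (cubeGeometry L K S T).Site → Finset (B7Prop1Explicit.Site d × Fin d × Fin d)) {ξ : ℝ}
    {Uhb : B7Prop1Explicit.Site d → Fin d → 𝔸ˣ}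
    (ev : B7Prop1Explicit.Site d → ((S → 𝔸) →L[ℝ] (Fin d → 𝔸))) {b3 : BlockNorm (cubeGeometry L K S T) 𝒵}
    (hev : ∀ (y : (cubeGeometry L K S T).Site) (v : S → 𝔸), ∀ x ∈ box y,
      ‖ev x v‖ ≤ (supSize (cubeGeometry L K S T) (boxS L K S T) (blkS L K S T) : BlockNorm (cubeGeometry L K S T) (S → 𝔸)).loc y v)
    (hev₁ : ∀ (y : (cubeGeometry L K S T).Site) (v : S → 𝔸),
      (covDerivBlockSize (cubeGeometry L K S T) y₀ Sc ξ Uhb).loc y (fun x => ev x v) ≤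
        (supSize (cubeGeometry L K S T) (boxS L K S T) (blkS L K S T) : BlockNorm (cubeGeometry L K S T) (S → 𝔸)).loc y v)
    {BG θW cΔ A₀ AH : ℝ} (hBG : 0 ≤ BG) (hθW : 0 ≤ θW) (hcΔ : 0 ≤ cΔ) (hA₀ : 0 ≤ A₀) (hAH : 0 ≤ AH)
    (hG190 : HasMaj b3 (supSize (cubeGeometry L K S T) (boxS L K S T) (blkS L K S T) : BlockNorm (cubeGeometry L K S T) (S → 𝔸))
      (𝒢.restrictScalars ℝ : 𝒵 →ₗ[ℝ] (S → 𝔸)) (fun y y' => BG * Real.exp (-(δ₀ * (cubeGeometry L K S T).dist y y'))))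
    (hD2H0 : HasMaj (supSize (cubeGeometry L K S T) (boxT L K S T) (blkT L K S T) : BlockNorm (cubeGeometry L K S T) (T → 𝔸)) b3
      ((D2 ∘L H₀).restrictScalars ℝ : (T → 𝔸) →ₗ[ℝ] 𝒵) (fun y y' => cΔ * Real.exp (-(δ₀ * (cubeGeometry L K S T).dist y y'))))
    (hH0 : HasMaj (supSize (cubeGeometry L K S T) (boxT L K S T) (blkT L K S T) : BlockNorm (cubeGeometry L K S T) (T → 𝔸))
      (supSize (cubeGeometry L K S T) (boxS L K S T) (blkS L K S T) : BlockNorm (cubeGeometry L K S T) (S → 𝔸))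
      (H₀.restrictScalars ℝ : (T → 𝔸) →ₗ[ℝ] (S → 𝔸)) (fun y y' => A₀ * Real.exp (-(δ₀ * (cubeGeometry L K S T).dist y y'))))
    (hH : HasMaj (supSize (cubeGeometry L K S T) (boxT L K S T) (blkT L K S T) : BlockNorm (cubeGeometry L K S T) (T → 𝔸))
      (supSize (cubeGeometry L K S T) (boxS L K S T) (blkS L K S T) : BlockNorm (cubeGeometry L K S T) (S → 𝔸))
      (H.restrictScalars ℝ : (T → 𝔸) →ₗ[ℝ] (S → 𝔸)) (fun y y' => AH * Real.exp (-(δ₀ / 2 * (cubeGeometry L K S T).dist y y'))))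
    (h189 : ∀ B' : T → 𝔸, ‖H₀ B'‖ < 𝔞 → ‖D2 (H₀ B')‖ < 𝔧 →
      Ineq189 (supSize (cubeGeometry L K S T) (boxS L K S T) (blkS L K S T) : BlockNorm (cubeGeometry L K S T) (S → 𝔸)) b3
        ((fderiv ℂ W (solA180 𝒢 W D2 H₀ ε₄ B' + H₀ B')).restrictScalars ℝ : (S → 𝔸) →ₗ[ℝ] 𝒵) θW δ₀)
    (hqG : qG b3.κ 1 BG θW (B6.c0 δ₀ (1 / 8) ^ d) < 1)
    -- the [IV] side: the letters of `B15From190LayerSizes.ineq196_twoSup_of_ineq190_layer` minus `h190₀,₁`, `hmv₀,₁`, `hdist`, `hrow`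
    {α' τ Dd B₃ δ M₂ εh γ gh : ℝ} {r R : ℕ}
    (hσ : 0 < α') (hτ : 0 ≤ τ) (hστ : α' * δ₀ + τ ≤ δ₀ / 8) (y : (cubeGeometry L K S T).Site) (hε : 0 < εh)
    (hs3 : C0 d * (εh * (1 / 2)) ≤ 1 / 3) (hs2 : 2 * (εh * (1 / 2)) ≤ c2' d L)
    (hs : 11 * (d : ℝ) ^ 2 * (εh * (1 / 2)) ≤ 1 / 6) (lo hi : B7Prop1Explicit.Site d) (hlohi : lo ≤ hi)
    (h190p : pdevOn (tlo L lo K) (thi L hi K) Wf < εh * (1 / 2) * (((L : ℝ) ^ K)⁻¹) ^ 2)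
    (h15 : ∀ n, n < K → ∀ z, tlo L lo n ≤ z → z ≤ thi L hi n → ∀ r : Fin d → Fin L,
      axialFn (avgIter L Wf (K - (n + 1))) ((L : ℤ) • z) ((L : ℤ) • z + boxVec L r) = 1)
    (hX : ∀ i, dep i ≤ K ∧ tlo L lo (dep i) ≤ pt i ∧ pt i + e (dir i) ≤ thi L hi (dep i))
    (hfar : ∀ y' i, i ∈ boxT L K S T y' → Dd ≤ (cubeGeometry L K S T).dist y y')
    (hξ : 0 < ξ) (hUhb : ∀ z κ, Uhb z κ ∈ U1 𝔸)
    {Hf₁ : B7Prop1Explicit.Site d → Fin d → 𝔸}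
    (hHf₁ : Hf₁ = fun x => ev x (chartH179 𝒢 W D2 H₀
      (fun Y : S → 𝔸 => Y - H (Dfix (B11Eq44Concrete.Cmap L U₁ S T K) (H : (T → 𝔸) →ₗ[ℂ] (S → 𝔸))
        ((8 * (131072 * ((d : ℝ) + 1) ^ 2) * Real.exp (4 * (800 * ((d : ℝ) + 1) ^ 2 * ((d : ℝ) + 4)) * α₁)) *
          ((L : ℝ) ^ K) ^ 2) Y)) ε₄
      (fun i => mlog (((avgIter L Wf (K - dep i) (pt i) (dir i) *
          (pullIter L (avgIter L Wf K) (dep i) (pt i) (dir i))⁻¹ : 𝔸ˣ) : 𝔸)))))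
    (hH₁sa : ∀ z κ, IsSelfAdjoint (Hf₁ z κ))
    {g₁ : B7Prop1Explicit.Site d → 𝔸ˣ} (hg₁ : ∀ z, g₁ z ∈ U1 𝔸)
    {V₁ : B7Prop1Explicit.Site d → Fin d → 𝔸ˣ} (hV₁ : ∀ z κ, V₁ z κ ∈ U1 𝔸)
    {H₂ : B7Prop1Explicit.Site d → Fin d → 𝔸} (hH₂sa : ∀ z κ, IsSelfAdjoint (H₂ z κ))
    {g₂ : B7Prop1Explicit.Site d → 𝔸ˣ} (hg₂ : ∀ z, g₂ z ∈ U1 𝔸)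
    (hrep : Uhb = gaugeAct g₂ (B8Lemma1NonAbelian.mulCfg (B8Eq146AExpansion.expCfg (B8Eq146AExpansion.iEta ξ H₂)) V₁))
    (μ ν : Fin d) (x : B7Prop1Explicit.Site d) {Linv Y₂ β t : ℝ}
    (hgeom : δ * 2 * L * M₂ * R ≤ τ * Dd)
    (hCB : const190 1 1 b3.κ BG θW cΔ A₀ AH
        (d * Real.exp (1 / 2 * d * δ₀) *
          ((1 - (C3Gen d L * (((L : ℝ) ^ K) ^ 2 * (2 * ε₃)) * (2 * d) * B₁ * Real.exp (2 * d * δ₀)) *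
              (d * B6.c0 δ₀ (1 / 2) ^ d))⁻¹ * (Real.exp (d * δ₀) * (C3Gen d L * ((L : ℝ) ^ K) ^ 2 * (2 * ε₃)))))
        (B6.c0 δ₀ (1 / 8) ^ d) * B6.c0 δ₀ α' ^ d ≤ B₃) (hB₃ : 0 < B₃)
    (hr : 1 ≤ r) (hR : B14.IsRj L r gh R) (hgh : 0 < gh) (hgγ : gh ≤ γ) (hγe : 1 ≤ Real.log (γ ^ 2)⁻¹)
    (hc1 : 1 < δ * 2 * L * M₂) (hRh : 0 < (R : ℝ)) (hγ : 11 * (d : ℝ) ^ 2 * B₃ * γ ^ 2 < 1 / 24)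
    (hx : x ∈ box y) (hxμ : x + e μ ∈ box y) (hxν : x + e ν ∈ box y)
    (hS₁ : (x, μ, ν) ∈ Sc y) (hS₂ : (x, ν, μ) ∈ Sc y)
    (hB₁' : ‖H₂ x μ‖ ≤ Y₂) (hB₂ : ‖H₂ (x + e μ) ν‖ ≤ Y₂) (hB₃' : ‖H₂ (x + e ν) μ‖ ≤ Y₂) (hB₄ : ‖H₂ x ν‖ ≤ Y₂)
    (hBD₁ : ‖B8Ineq132.covDerivFwd ξ V₁ μ (fun z => H₂ z ν) x‖ ≤ Y₂)
    (hBD₂ : ‖B8Ineq132.covDerivFwd ξ V₁ ν (fun z => H₂ z μ) x‖ ≤ Y₂) (hY₂ : Y₂ < 1 / 24 * εh)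
    (hhalf : ‖B8Ineq132.plaqF V₁ μ ν x - 1‖ < 1 / 2 * (εh * ξ ^ 2)) (hL0 : 0 ≤ Linv) (hL1 : Linv ≤ 1)
    (hε1 : εh ≤ 1 / 10) (hβ : β ≤ 1 / 4) (ht0 : 0 < t) (ht1 : t ≤ 1) :
    B15.BasicStep.Ineq196 ‖B8Ineq132.plaqF (gaugeAct g₁ (B8Lemma1NonAbelian.mulCfg (B8Eq146AExpansion.expCfg
        (B8Eq146AExpansion.iEta ξ Hf₁)) Uhb)) μ ν x - 1‖ β t (εh * ξ ^ 2) := by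
  obtain ⟨h190₀, hmv₀⟩ := ineq190_and_hmv_supSize_concreteC_kernel L hL hAG k₁ U₁ hU₁ hα₁ hα₁3 hα₁4 h52₁ hb₁ hsmall₁ hc₃₁
    h145₁ h155₁ S T hK hd1 Reg hWa H hB₀' hH46 hc1h hε₃ h18 h2 hnest hδ₀ hB₁ hHker hq hB ev hev hBG hθW hcΔ hA₀ hAH hG190
    hD2H0 hH0 hH h189 hqG
    (fun B' => fun x => ev x (chartH179 𝒢 W D2 H₀
      (fun Y : S → 𝔸 => Y - H (Dfix (B11Eq44Concrete.Cmap L U₁ S T K) (H : (T → 𝔸) →ₗ[ℂ] (S → 𝔸))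
        ((8 * (131072 * ((d : ℝ) + 1) ^ 2) * Real.exp (4 * (800 * ((d : ℝ) + 1) ^ 2 * ((d : ℝ) + 4)) * α₁)) *
          ((L : ℝ) ^ K) ^ 2) Y)) ε₄ B'))
    (fun t => (LinearMap.pi fun x => ((ev x : (S → 𝔸) →L[ℝ] (Fin d → 𝔸)) : (S → 𝔸) →ₗ[ℝ] (Fin d → 𝔸))) ∘ₗ
      ((fderiv ℂ (chartH179 𝒢 W D2 H₀
        (fun Y : S → 𝔸 => Y - H (Dfix (B11Eq44Concrete.Cmap L U₁ S T K) (H : (T → 𝔸) →ₗ[ℂ] (S → 𝔸))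
          ((8 * (131072 * ((d : ℝ) + 1) ^ 2) * Real.exp (4 * (800 * ((d : ℝ) + 1) ^ 2 * ((d : ℝ) + 4)) * α₁)) *
            ((L : ℝ) ^ K) ^ 2) Y)) ε₄)
        ((t : ℝ) • (fun i => mlog (((avgIter L Wf (K - dep i) (pt i) (dir i) *
          (pullIter L (avgIter L Wf K) (dep i) (pt i) (dir i))⁻¹ : 𝔸ˣ) : 𝔸))))).restrictScalars ℝ :
            (T → 𝔸) →ₗ[ℝ] (S → 𝔸)))
    (fun _ => rfl) (fun _ => rfl) y
  obtain ⟨h190₁, hmv₁⟩ := B11Ineq190DerivConcreteC.ineq190_and_hmv_covDerivBlockSize_concreteC_kernel L hL hAG k₁ U₁ hU₁ hα₁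
    hα₁3 hα₁4 h52₁ hb₁ hsmall₁ hc₃₁ h145₁ h155₁ S T hK hd1 Reg hWa H hB₀' hH46 hc1h hε₃ h18 h2 hnest hδ₀ hB₁ hHker hq hB y₀ Sc
    ev hev₁ hBG hθW hcΔ hA₀ hAH hG190 hD2H0 hH0 hH h189 hqG
    (fun B' => fun x => ev x (chartH179 𝒢 W D2 H₀
      (fun Y : S → 𝔸 => Y - H (Dfix (B11Eq44Concrete.Cmap L U₁ S T K) (H : (T → 𝔸) →ₗ[ℂ] (S → 𝔸))
        ((8 * (131072 * ((d : ℝ) + 1) ^ 2) * Real.exp (4 * (800 * ((d : ℝ) + 1) ^ 2 * ((d : ℝ) + 4)) * α₁)) *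
          ((L : ℝ) ^ K) ^ 2) Y)) ε₄ B'))
    (fun t => (LinearMap.pi fun x => ((ev x : (S → 𝔸) →L[ℝ] (Fin d → 𝔸)) : (S → 𝔸) →ₗ[ℝ] (Fin d → 𝔸))) ∘ₗ
      ((fderiv ℂ (chartH179 𝒢 W D2 H₀
        (fun Y : S → 𝔸 => Y - H (Dfix (B11Eq44Concrete.Cmap L U₁ S T K) (H : (T → 𝔸) →ₗ[ℂ] (S → 𝔸))
          ((8 * (131072 * ((d : ℝ) + 1) ^ 2) * Real.exp (4 * (800 * ((d : ℝ) + 1) ^ 2 * ((d : ℝ) + 4)) * α₁)) *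
            ((L : ℝ) ^ K) ^ 2) Y)) ε₄)
        ((t : ℝ) • (fun i => mlog (((avgIter L Wf (K - dep i) (pt i) (dir i) *
          (pullIter L (avgIter L Wf K) (dep i) (pt i) (dir i))⁻¹ : 𝔸ˣ) : 𝔸))))).restrictScalars ℝ :
            (T → 𝔸) →ₗ[ℝ] (S → 𝔸)))
    (fun _ => rfl) (fun _ => rfl) y
  have hKc : 0 ≤ const190 1 1 b3.κ BG θW cΔ A₀ AH
      (d * Real.exp (1 / 2 * d * δ₀) *
        ((1 - (C3Gen d L * (((L : ℝ) ^ K) ^ 2 * (2 * ε₃)) * (2 * d) * B₁ * Real.exp (2 * d * δ₀)) *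
            (d * B6.c0 δ₀ (1 / 2) ^ d))⁻¹ * (Real.exp (d * δ₀) * (C3Gen d L * ((L : ℝ) ^ K) ^ 2 * (2 * ε₃)))))
      (B6.c0 δ₀ (1 / 8) ^ d) :=
    const190_nonneg' zero_le_one zero_le_one b3.κ_nonneg (c0_pow_nonneg δ₀ (1 / 8) d) hBG hθW hcΔ hA₀ hAH
      (thetaD_nonneg hε₃.le hq) hqG
  have hrow : RowSum (cubeGeometry L K S T) (α' * δ₀) (B6.c0 δ₀ α' ^ d) := rowSum_cubeGeometry L K S T (mul_pos hσ hδ₀)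
  subst hHf₁
  exact ineq196_twoSup_of_ineq190_layer (boxT L K S T) (blkT L K S T) dep pt dir box blk y₀ Sc h190₀ h190₁ hKc
    (dist_nonneg_cubeGeometry L K S T) hrow hτ hστ y hL hd1 hAG Wf hWf hε hs3 hs2 hs lo hi hlohi h190p h15 hX hfar hξ hUhb hH₁sa
    hg₁ hV₁ hH₂sa hg₂ hrep μ ν x hmv₀ hmv₁ hgeom hCB hB₃ hr hR hgh hgγ hγe hc1 hRh hγ hx hxμ hxν hS₁ hS₂ hB₁' hB₂ hB₃' hB₄
    hBD₁ hBD₂ hY₂ hhalf hL0 hL1 hε1 hβ ht0 ht1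

end Eq196C

end Literature.MathematicalPhysics.QuantumFieldTheory.Balaban1983to89.B15From190ConcreteC

end
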